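import Mathlib.Analysis.ODE.Gronwall
import Literature.Analysis.FluidPDE.CompressibleEulerLinearizedEnergy
import Literature.Analysis.FluidPDE.CompressibleEulerDifferentiatedSystem
import Literature.Analysis.FluidPDE.CompressibleEulerEnergySizes
import Literature.Analysis.FluidPDE.CompressibleEulerSlabBounds
import HarnessLib

/-!
# The `H³` a-priori estimate for classical solutions of the nonisentropic Euler system on `𝕋³`

Analysis/FluidPDE support file (everything proved; no named facts), part of the programme
proving `Literature.Analysis.FluidPDE.CompressibleEulerLocalWellPosedness` (Majda 1984,
Thms 2.1–2.2). This file proves the heart of Majda's continuation principle (Majda 1984, Thm 2.2,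
in the sharp `C¹` form): along a classical solution of the compressible Euler system of the
athermal monatomic law on `[0, τ] × 𝕋³` whose range stays in a fixed compact set of state space
and whose `C¹` norm stays `≤ M`, the third-order Sobolev energy
`E₃(t) = ∑_{|α| ≤ 3} ∫ (|∂^α ρ|² + ‖∂^α u‖² + |∂^α ϑ|²)` obeys a differential inequality
`ℰ' ≤ α ℰ + β` for the equivalent weighted energy `ℰ` (weights `a = ϑh'(ρ)/ρ`, `ρ`,
`d₃ = (3/2)ρ/ϑ`), with `α, β` depending only on `M`, the density ceiling and `ζ`; hence
`E₃(t) ≤ R(E₃(0), M, T)` uniformly on every slab `[0, τ] ⊂ [0, T)` (`apriori_slab`,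
`apriori_Ico`).

Ingredients: the integrated energy identity `linearizedEnergy_hasDerivWithinAt` applied to each of
the 40 derivative words of order `≤ 3` (`CompressibleEulerDifferentiatedSystem` identifies their
residuals), the pointwise commutator bounds `cont_/mom_/temp_level₁₂₃`
(`CompressibleEulerResidualBounds`), their `L²` conversion including the `L⁴` interpolation
(`CompressibleEulerEnergySizes`), the uniform coefficient bounds `exists_slab_bounds`, and
Grönwall (`le_gronwallBound_of_liminf_deriv_right_le`).

## References

* A. Majda, *Compressible Fluid Flow and Systems of Conservation Laws in Several Space
  Variables*, Springer 1984, Ch. 2 §2.1, Thm 2.2 and its proof ((2.8)–(2.10)). [`Majda1984`]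
-/

noncomputable section

open Set Function MeasureTheory
open scoped ContDiff InnerProductSpace

namespace Literature.Analysis.FluidPDE

namespace CompressibleEuler

open Literature.Analysis.FunctionSpaces FunctionSpaces.Torus

/-! ## The pointwise bound for the integrand of the energy identity (explicit constants) -/

/-- With `0 ≤ a, c, d ≤ B`, `|A|, |C|, |D|, |X|, |Y|, |Z| ≤ B` and `|P|, |Q| ≤ 3B‖w‖`:
`2arR₁ + 2c⟪w,R₂⟫ + 2dθR₃ + (Ar² + C‖w‖² + Dθ²) + (r²X + ‖w‖²Y + θ²Z) + 2rP + 2θQ`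
`≤ 9B(r² + ‖w‖² + θ²) + B(R₁² + ‖R₂‖² + R₃²)`. [folklore] -/
theorem energyIntegrand_le_sq {E : Type*} [NormedAddCommGroup E] [InnerProductSpace ℝ E]
    {r θ a c d A C D X Y Z P Q R₁ R₃ B : ℝ} {w R₂ : E}
    (ha0 : 0 ≤ a) (ha : a ≤ B) (hc0 : 0 ≤ c) (hc : c ≤ B) (hd0 : 0 ≤ d) (hd : d ≤ B)
    (hA : |A| ≤ B) (hC : |C| ≤ B) (hD : |D| ≤ B) (hX : |X| ≤ B) (hY : |Y| ≤ B) (hZ : |Z| ≤ B)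
    (hP : |P| ≤ 3 * B * ‖w‖) (hQ : |Q| ≤ 3 * B * ‖w‖) :
    2 * a * r * R₁ + 2 * c * ⟪w, R₂⟫_ℝ + 2 * d * θ * R₃ + (A * r ^ 2 + C * ‖w‖ ^ 2 + D * θ ^ 2) +
        (r ^ 2 * X + ‖w‖ ^ 2 * Y + θ ^ 2 * Z) + 2 * r * P + 2 * θ * Q ≤
      9 * B * (r ^ 2 + ‖w‖ ^ 2 + θ ^ 2) + B * (R₁ ^ 2 + ‖R₂‖ ^ 2 + R₃ ^ 2) := by
  have hB : 0 ≤ B := ha0.trans ha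
  have hw0 : 0 ≤ ‖w‖ := norm_nonneg _
  -- (1)-(3): `2 a r R ≤ a (r² + R²)`
  have e1 : 2 * a * r * R₁ ≤ B * r ^ 2 + B * R₁ ^ 2 := by
    have h1 : 2 * a * r * R₁ ≤ a * (r ^ 2 + R₁ ^ 2) := by nlinarith [sq_nonneg (r - R₁)]
    nlinarith [sq_nonneg r, sq_nonneg R₁]
  have e2 : 2 * c * ⟪w, R₂⟫_ℝ ≤ B * ‖w‖ ^ 2 + B * ‖R₂‖ ^ 2 := by
    have hi : |⟪w, R₂⟫_ℝ| ≤ ‖w‖ * ‖R₂‖ := abs_real_inner_le_norm _ _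
    have h1 : 2 * c * ⟪w, R₂⟫_ℝ ≤ 2 * c * (‖w‖ * ‖R₂‖) := by
      have := le_abs_self ⟪w, R₂⟫_ℝ
      nlinarith
    have h2 : 2 * (‖w‖ * ‖R₂‖) ≤ ‖w‖ ^ 2 + ‖R₂‖ ^ 2 := by nlinarith [sq_nonneg (‖w‖ - ‖R₂‖)]
    nlinarith [sq_nonneg ‖w‖, sq_nonneg ‖R₂‖]
  have e3 : 2 * d * θ * R₃ ≤ B * θ ^ 2 + B * R₃ ^ 2 := by
    have h1 : 2 * d * θ * R₃ ≤ d * (θ ^ 2 + R₃ ^ 2) := by nlinarith [sq_nonneg (θ - R₃)]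
    nlinarith [sq_nonneg θ, sq_nonneg R₃]
  -- (4), (5)
  have e4 : A * r ^ 2 + C * ‖w‖ ^ 2 + D * θ ^ 2 ≤ B * (r ^ 2 + ‖w‖ ^ 2 + θ ^ 2) := by
    have i1 := mul_le_mul_of_nonneg_right ((le_abs_self A).trans hA) (sq_nonneg r)
    have i2 := mul_le_mul_of_nonneg_right ((le_abs_self C).trans hC) (sq_nonneg ‖w‖)
    have i3 := mul_le_mul_of_nonneg_right ((le_abs_self D).trans hD) (sq_nonneg θ)
    linarith
  have e5 : r ^ 2 * X + ‖w‖ ^ 2 * Y + θ ^ 2 * Z ≤ B * (r ^ 2 + ‖w‖ ^ 2 + θ ^ 2) := by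
    have i1 := mul_le_mul_of_nonneg_left ((le_abs_self X).trans hX) (sq_nonneg r)
    have i2 := mul_le_mul_of_nonneg_left ((le_abs_self Y).trans hY) (sq_nonneg ‖w‖)
    have i3 := mul_le_mul_of_nonneg_left ((le_abs_self Z).trans hZ) (sq_nonneg θ)
    linarith
  -- (6), (7): `2 r P ≤ 2|r| 3B‖w‖ ≤ 3B (r² + ‖w‖²)`
  have e6 : 2 * r * P ≤ 3 * B * (r ^ 2 + ‖w‖ ^ 2) := by
    have h1 : 2 * r * P ≤ 2 * |r| * (3 * B * ‖w‖) := by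
      have := abs_mul_abs_self r
      calc 2 * r * P ≤ |2 * r * P| := le_abs_self _
        _ = 2 * |r| * |P| := by rw [abs_mul, abs_mul, abs_two]
        _ ≤ 2 * |r| * (3 * B * ‖w‖) := by gcongr
    nlinarith [sq_nonneg (|r| - ‖w‖), sq_abs r, abs_nonneg r]
  have e7 : 2 * θ * Q ≤ 3 * B * (θ ^ 2 + ‖w‖ ^ 2) := by
    have h1 : 2 * θ * Q ≤ 2 * |θ| * (3 * B * ‖w‖) := by
      calc 2 * θ * Q ≤ |2 * θ * Q| := le_abs_self _
        _ = 2 * |θ| * |Q| := by rw [abs_mul, abs_mul, abs_two]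
        _ ≤ 2 * |θ| * (3 * B * ‖w‖) := by gcongr
    nlinarith [sq_nonneg (|θ| - ‖w‖), sq_abs θ, abs_nonneg θ]
  nlinarith [sq_nonneg r, sq_nonneg θ, sq_nonneg ‖w‖]

/-! ## One word: derivative of the weighted energy and its bound -/

section Word

variable {τ : ℝ} {r θ a b c g d : ℝ → UnitAddTorus (Fin 3) → ℝ}
  {w v : ℝ → UnitAddTorus (Fin 3) → EuclideanSpace ℝ (Fin 3)}

/-- **Energy inequality for one derivative word.** For smooth fields `(r, w, θ)` on a slab with
residuals `(P₁, P₂, P₃)` in the linearised symmetric system (coefficients `v, a, b, c, g`, weight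
`d` with `d g = c b`), under the sup bounds `B` of `exists_slab_bounds` and `∫ P² ≤ Φ`, the weighted
energy `e(s) = ∫ (a r² + c‖w‖² + dθ²)` is differentiable within the slab at `t` with
`e'(t) ≤ 9B ∫ (r² + ‖w‖² + θ²) + 3BΦ` (Majda 1984, (2.9)–(2.10); mind the parentheses around
the integral in the formal statement).
[cite: Majda1984, Ch. 2 §2.1, proof of Thm 2.2] -/
theorem word_deriv_le (hτ : 0 < τ) (hr : IsSmoothSpaceTimeOn (Icc 0 τ) r) (hθ : IsSmoothSpaceTimeOn (Icc 0 τ) θ)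
    (hw : IsSmoothSpaceTimeOn (Icc 0 τ) w) (hv : IsSmoothSpaceTimeOn (Icc 0 τ) v)
    (ha : IsSmoothSpaceTimeOn (Icc 0 τ) a) (hc : IsSmoothSpaceTimeOn (Icc 0 τ) c)
    (hg : IsSmoothSpaceTimeOn (Icc 0 τ) g) (hd : IsSmoothSpaceTimeOn (Icc 0 τ) d) {t : ℝ} (ht : t ∈ Icc 0 τ)
    (hm : ∀ x, d t x * g t x = c t x * b t x) {B : ℝ} (hB : 0 ≤ B)
    (hbd : ∀ x, 0 ≤ a t x ∧ a t x ≤ B ∧ 0 ≤ c t x ∧ c t x ≤ B ∧ 0 ≤ d t x ∧ d t x ≤ B ∧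
      |timeDerivWithin (Icc 0 τ) a t x| ≤ B ∧ |timeDerivWithin (Icc 0 τ) c t x| ≤ B ∧
      |timeDerivWithin (Icc 0 τ) d t x| ≤ B ∧
      |divergence (fun y => a t y • v t y) x| ≤ B ∧ |divergence (fun y => c t y • v t y) x| ≤ B ∧
      |divergence (fun y => d t y • v t y) x| ≤ B ∧
      ∀ i, |partialDeriv i (fun y => a t y * c t y) x| ≤ B ∧ |partialDeriv i (fun y => d t y * g t y) x| ≤ B)
    {P₁ P₃ : UnitAddTorus (Fin 3) → ℝ} {P₂ : UnitAddTorus (Fin 3) → EuclideanSpace ℝ (Fin 3)}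
    (hP₁ : IsSmooth P₁) (hP₂ : IsSmooth P₂) (hP₃ : IsSmooth P₃)
    (hR₁ : ∀ x, timeDerivWithin (Icc 0 τ) r t x + (∑ i, v t x i * partialDeriv i (r t) x) +
      c t x * divergence (w t) x = P₁ x)
    (hR₂ : ∀ x, timeDerivWithin (Icc 0 τ) w t x + (∑ i, v t x i • partialDeriv i (w t) x) +
      a t x • gradient (r t) x + b t x • gradient (θ t) x = P₂ x)
    (hR₃ : ∀ x, timeDerivWithin (Icc 0 τ) θ t x + (∑ i, v t x i * partialDeriv i (θ t) x) +
      g t x * divergence (w t) x = P₃ x)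
    {Φ : ℝ} (h₁ : ∫ x, P₁ x ^ 2 ≤ Φ) (h₂ : ∫ x, ‖P₂ x‖ ^ 2 ≤ Φ) (h₃ : ∫ x, P₃ x ^ 2 ≤ Φ) :
    ∃ D : ℝ, HasDerivWithinAt
        (fun s => ∫ x, (a s x * r s x ^ 2 + c s x * ‖w s x‖ ^ 2 + d s x * θ s x ^ 2)) D (Icc 0 τ) t ∧
      D ≤ 9 * B * ((∫ x, r t x ^ 2) + (∫ x, ‖w t x‖ ^ 2) + ∫ x, θ t x ^ 2) + 3 * (B * Φ) := by
  have hD := linearizedEnergy_hasDerivWithinAt hr hθ hw hv ha hc hg hd (convex_Icc 0 τ) (uniqueDiffOn_Icc hτ) ht hm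
  refine ⟨_, hD, ?_⟩
  have hΦ : 0 ≤ Φ := (integral_nonneg fun x => sq_nonneg _).trans h₁
  -- smooth slices
  have hrs := hr.isSmooth_slice ht
  have hθs := hθ.isSmooth_slice ht
  have hws := hw.isSmooth_slice ht
  set q : UnitAddTorus (Fin 3) → ℝ := fun x => r t x ^ 2 + ‖w t x‖ ^ 2 + θ t x ^ 2 with hqdef
  set U : UnitAddTorus (Fin 3) → ℝ := fun x => 9 * B * q x + B * (P₁ x ^ 2 + ‖P₂ x‖ ^ 2 + P₃ x ^ 2) with hUdef
  have hr2 : IsSmooth (fun x => r t x ^ 2) := hrs.pow 2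
  have hw2 : IsSmooth (fun x => ‖w t x‖ ^ 2) := hws.norm_sq
  have hθ2 : IsSmooth (fun x => θ t x ^ 2) := hθs.pow 2
  have hqs : IsSmooth q := (hr2.add hw2).add hθ2
  have esum : (∫ x, r t x ^ 2) + (∫ x, ‖w t x‖ ^ 2) + ∫ x, θ t x ^ 2 = ∫ x, q x := by
    have i12 : Integrable (fun x => r t x ^ 2 + ‖w t x‖ ^ 2) volume := hr2.integrable.add hw2.integrable
    rw [hqdef]
    simp only
    rw [integral_add i12 hθ2.integrable, integral_add hr2.integrable hw2.integrable]
  rw [esum]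
  have hP1s : IsSmooth (fun x => P₁ x ^ 2) := hP₁.pow 2
  have hP2s : IsSmooth (fun x => ‖P₂ x‖ ^ 2) := hP₂.norm_sq
  have hP3s : IsSmooth (fun x => P₃ x ^ 2) := hP₃.pow 2
  have hPs : IsSmooth (fun x => P₁ x ^ 2 + ‖P₂ x‖ ^ 2 + P₃ x ^ 2) := (hP1s.add hP2s).add hP3s
  have hUi : Integrable U volume := (hqs.integrable.const_mul _).add (hPs.integrable.const_mul _)
  -- pointwise bound
  have hpt : ∀ x,
      2 * a t x * r t x * (timeDerivWithin (Icc 0 τ) r t x + (∑ i, v t x i * partialDeriv i (r t) x) +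
          c t x * divergence (w t) x) +
        2 * c t x * ⟪w t x, timeDerivWithin (Icc 0 τ) w t x + (∑ i, v t x i • partialDeriv i (w t) x) +
          a t x • gradient (r t) x + b t x • gradient (θ t) x⟫_ℝ +
        2 * d t x * θ t x * (timeDerivWithin (Icc 0 τ) θ t x + (∑ i, v t x i * partialDeriv i (θ t) x) +
          g t x * divergence (w t) x) +
        (timeDerivWithin (Icc 0 τ) a t x * r t x ^ 2 + timeDerivWithin (Icc 0 τ) c t x * ‖w t x‖ ^ 2 +
          timeDerivWithin (Icc 0 τ) d t x * θ t x ^ 2) +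
        (r t x ^ 2 * divergence (fun y => a t y • v t y) x + ‖w t x‖ ^ 2 * divergence (fun y => c t y • v t y) x +
          θ t x ^ 2 * divergence (fun y => d t y • v t y) x) +
        2 * r t x * (∑ i, w t x i * partialDeriv i (fun y => a t y * c t y) x) +
        2 * θ t x * (∑ i, w t x i * partialDeriv i (fun y => d t y * g t y) x) ≤ U x := by
    intro x
    obtain ⟨a0, aB, c0, cB, d0, dB, tA, tC, tD, dX, dY, dZ, hPQ⟩ := hbd x
    rw [hR₁ x, hR₂ x, hR₃ x]
    have hP : |∑ i, w t x i * partialDeriv i (fun y => a t y * c t y) x| ≤ 3 * B * ‖w t x‖ := by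
      have h := abs_sum_coord_mul_le₃ (le_refl ‖w t x‖) fun i => (hPQ i).1
      linarith
    have hQ : |∑ i, w t x i * partialDeriv i (fun y => d t y * g t y) x| ≤ 3 * B * ‖w t x‖ := by
      have h := abs_sum_coord_mul_le₃ (le_refl ‖w t x‖) fun i => (hPQ i).2
      linarith
    have e := energyIntegrand_le_sq (r := r t x) (θ := θ t x) (w := w t x) (R₁ := P₁ x) (R₂ := P₂ x) (R₃ := P₃ x)
      a0 aB c0 cB d0 dB tA tC tD dX dY dZ hP hQ
    simpa only [hUdef, hqdef] using e
  have hUint : ∫ x, U x ≤ 9 * B * (∫ x, q x) + 3 * (B * Φ) := by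
    have i12 : Integrable (fun x => P₁ x ^ 2 + ‖P₂ x‖ ^ 2) volume := hP1s.integrable.add hP2s.integrable
    simp only [hUdef]
    rw [integral_add (hqs.integrable.const_mul _) (hPs.integrable.const_mul _), integral_const_mul, integral_const_mul,
      integral_add i12 hP3s.integrable, integral_add hP1s.integrable hP2s.integrable]
    have : B * ((∫ x, P₁ x ^ 2) + (∫ x, ‖P₂ x‖ ^ 2) + ∫ x, P₃ x ^ 2) ≤ B * (Φ + Φ + Φ) :=
      mul_le_mul_of_nonneg_left (by linarith) hB
    linarith
  by_cases hint : Integrable (fun x =>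
      2 * a t x * r t x * (timeDerivWithin (Icc 0 τ) r t x + (∑ i, v t x i * partialDeriv i (r t) x) +
          c t x * divergence (w t) x) +
        2 * c t x * ⟪w t x, timeDerivWithin (Icc 0 τ) w t x + (∑ i, v t x i • partialDeriv i (w t) x) +
          a t x • gradient (r t) x + b t x • gradient (θ t) x⟫_ℝ +
        2 * d t x * θ t x * (timeDerivWithin (Icc 0 τ) θ t x + (∑ i, v t x i * partialDeriv i (θ t) x) +
          g t x * divergence (w t) x) +
        (timeDerivWithin (Icc 0 τ) a t x * r t x ^ 2 + timeDerivWithin (Icc 0 τ) c t x * ‖w t x‖ ^ 2 +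
          timeDerivWithin (Icc 0 τ) d t x * θ t x ^ 2) +
        (r t x ^ 2 * divergence (fun y => a t y • v t y) x + ‖w t x‖ ^ 2 * divergence (fun y => c t y • v t y) x +
          θ t x ^ 2 * divergence (fun y => d t y • v t y) x) +
        2 * r t x * (∑ i, w t x i * partialDeriv i (fun y => a t y * c t y) x) +
        2 * θ t x * (∑ i, w t x i * partialDeriv i (fun y => d t y * g t y) x)) volume
  · exact (integral_mono hint hUi hpt).trans hUint
  · rw [integral_undef hint]
    have : 0 ≤ ∫ x, q x := integral_nonneg fun x => by simp only [hqdef]; positivity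
    positivity

end Word

/-! ## The energies -/

section Energies

variable {d : Type*} [Fintype d] [DecidableEq d]

/-- Level-0 part of the Sobolev energy: `∫ρ² + ∫‖u‖² + ∫ϑ²`. [folklore] -/
def en₀ (ρ : UnitAddTorus d → ℝ) (u : UnitAddTorus d → EuclideanSpace ℝ d) (ϑ : UnitAddTorus d → ℝ) : ℝ :=
  (∫ x, ρ x ^ 2) + (∫ x, ‖u x‖ ^ 2) + ∫ x, ϑ x ^ 2

/-- Level-1 part: `∑ⱼ (∫(∂ⱼρ)² + ∫‖∂ⱼu‖² + ∫(∂ⱼϑ)²)`. [folklore] -/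
def en₁ (ρ : UnitAddTorus d → ℝ) (u : UnitAddTorus d → EuclideanSpace ℝ d) (ϑ : UnitAddTorus d → ℝ) : ℝ :=
  ∑ j, ((∫ x, partialDeriv j ρ x ^ 2) + (∫ x, ‖partialDeriv j u x‖ ^ 2) + ∫ x, partialDeriv j ϑ x ^ 2)

/-- Level-2 part: `∑ⱼₖ (∫(∂ₖ∂ⱼρ)² + ∫‖∂ₖ∂ⱼu‖² + ∫(∂ₖ∂ⱼϑ)²)`. [folklore] -/
def en₂ (ρ : UnitAddTorus d → ℝ) (u : UnitAddTorus d → EuclideanSpace ℝ d) (ϑ : UnitAddTorus d → ℝ) : ℝ :=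
  ∑ j, ∑ k, ((∫ x, partialDeriv k (partialDeriv j ρ) x ^ 2) + (∫ x, ‖partialDeriv k (partialDeriv j u) x‖ ^ 2) +
    ∫ x, partialDeriv k (partialDeriv j ϑ) x ^ 2)

/-- Level-3 part. [folklore] -/
def en₃ (ρ : UnitAddTorus d → ℝ) (u : UnitAddTorus d → EuclideanSpace ℝ d) (ϑ : UnitAddTorus d → ℝ) : ℝ :=
  ∑ j, ∑ k, ∑ l, ((∫ x, partialDeriv l (partialDeriv k (partialDeriv j ρ)) x ^ 2) +
    (∫ x, ‖partialDeriv l (partialDeriv k (partialDeriv j u)) x‖ ^ 2) +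
    ∫ x, partialDeriv l (partialDeriv k (partialDeriv j ϑ)) x ^ 2)

/-- **The third-order Sobolev energy** `E₃(ρ, u, ϑ) = ∑_{|α| ≤ 3} (∫|∂^αρ|² + ∫‖∂^αu‖² + ∫|∂^αϑ|²)`
(sum over ordered derivative words of length `≤ 3`). [cite: Majda1984, Ch. 2 §2.1 (2.8)] -/
def sobolevEnergy₃ (ρ : UnitAddTorus d → ℝ) (u : UnitAddTorus d → EuclideanSpace ℝ d) (ϑ : UnitAddTorus d → ℝ) : ℝ :=
  en₀ ρ u ϑ + en₁ ρ u ϑ + en₂ ρ u ϑ + en₃ ρ u ϑ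

omit [DecidableEq d] in
/-- `en₀ ≥ 0`. [folklore] -/
theorem en₀_nonneg (ρ : UnitAddTorus d → ℝ) (u : UnitAddTorus d → EuclideanSpace ℝ d) (ϑ : UnitAddTorus d → ℝ) :
    0 ≤ en₀ ρ u ϑ := by
  unfold en₀
  have h1 : 0 ≤ ∫ x, ρ x ^ 2 := integral_nonneg fun x => sq_nonneg (ρ x)
  have h2 : 0 ≤ ∫ x, ‖u x‖ ^ 2 := integral_nonneg fun x => sq_nonneg ‖u x‖
  have h3 : 0 ≤ ∫ x, ϑ x ^ 2 := integral_nonneg fun x => sq_nonneg (ϑ x)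
  positivity

/-- `en₁ ≥ 0`. [folklore] -/
theorem en₁_nonneg (ρ : UnitAddTorus d → ℝ) (u : UnitAddTorus d → EuclideanSpace ℝ d) (ϑ : UnitAddTorus d → ℝ) :
    0 ≤ en₁ ρ u ϑ :=
  Finset.sum_nonneg fun j _ => by
    have h1 : 0 ≤ ∫ x, partialDeriv j ρ x ^ 2 := integral_nonneg fun x => sq_nonneg _
    have h2 : 0 ≤ ∫ x, ‖partialDeriv j u x‖ ^ 2 := integral_nonneg fun x => sq_nonneg _
    have h3 : 0 ≤ ∫ x, partialDeriv j ϑ x ^ 2 := integral_nonneg fun x => sq_nonneg _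
    positivity

/-- `en₂ ≥ 0`. [folklore] -/
theorem en₂_nonneg (ρ : UnitAddTorus d → ℝ) (u : UnitAddTorus d → EuclideanSpace ℝ d) (ϑ : UnitAddTorus d → ℝ) :
    0 ≤ en₂ ρ u ϑ :=
  Finset.sum_nonneg fun j _ => Finset.sum_nonneg fun k _ => by
    have h1 : 0 ≤ ∫ x, partialDeriv k (partialDeriv j ρ) x ^ 2 := integral_nonneg fun x => sq_nonneg _
    have h2 : 0 ≤ ∫ x, ‖partialDeriv k (partialDeriv j u) x‖ ^ 2 := integral_nonneg fun x => sq_nonneg _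
    have h3 : 0 ≤ ∫ x, partialDeriv k (partialDeriv j ϑ) x ^ 2 := integral_nonneg fun x => sq_nonneg _
    positivity

/-- `en₃ ≥ 0`. [folklore] -/
theorem en₃_nonneg (ρ : UnitAddTorus d → ℝ) (u : UnitAddTorus d → EuclideanSpace ℝ d) (ϑ : UnitAddTorus d → ℝ) :
    0 ≤ en₃ ρ u ϑ :=
  Finset.sum_nonneg fun j _ => Finset.sum_nonneg fun k _ => Finset.sum_nonneg fun l _ => by
    have h1 : 0 ≤ ∫ x, partialDeriv l (partialDeriv k (partialDeriv j ρ)) x ^ 2 := integral_nonneg fun x => sq_nonneg _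
    have h2 : 0 ≤ ∫ x, ‖partialDeriv l (partialDeriv k (partialDeriv j u)) x‖ ^ 2 :=
      integral_nonneg fun x => sq_nonneg _
    have h3 : 0 ≤ ∫ x, partialDeriv l (partialDeriv k (partialDeriv j ϑ)) x ^ 2 := integral_nonneg fun x => sq_nonneg _
    positivity

/-- `E₃ ≥ 0`. [folklore] -/
theorem sobolevEnergy₃_nonneg (ρ : UnitAddTorus d → ℝ) (u : UnitAddTorus d → EuclideanSpace ℝ d)
    (ϑ : UnitAddTorus d → ℝ) : 0 ≤ sobolevEnergy₃ ρ u ϑ := by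
  unfold sobolevEnergy₃
  have := en₀_nonneg ρ u ϑ; have := en₁_nonneg ρ u ϑ; have := en₂_nonneg ρ u ϑ; have := en₃_nonneg ρ u ϑ
  positivity

/-- `en₂ = hsq₂ ρ + vsq₂ u + hsq₂ ϑ`. [folklore] -/
theorem en₂_eq (ρ : UnitAddTorus d → ℝ) (u : UnitAddTorus d → EuclideanSpace ℝ d) (ϑ : UnitAddTorus d → ℝ) :
    en₂ ρ u ϑ = hsq₂ ρ + vsq₂ u + hsq₂ ϑ := by
  simp only [en₂, hsq₂, vsq₂, Finset.sum_add_distrib]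

/-- `en₃ = hsq₃ ρ + vsq₃ u + hsq₃ ϑ`. [folklore] -/
theorem en₃_eq (ρ : UnitAddTorus d → ℝ) (u : UnitAddTorus d → EuclideanSpace ℝ d) (ϑ : UnitAddTorus d → ℝ) :
    en₃ ρ u ϑ = hsq₃ ρ + vsq₃ u + hsq₃ ϑ := by
  simp only [en₃, hsq₃, vsq₃, Finset.sum_add_distrib]

omit [DecidableEq d] in
/-- **Weighted vs unweighted, one word**: `δ ∫ q ≤ ∫ (a r² + c‖w‖² + dθ²) ≤ B ∫ q` (with the three
integrals of `q` split). [folklore] -/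
theorem weighted_word_bounds {r θ a c d₃ : UnitAddTorus d → ℝ} {w : UnitAddTorus d → EuclideanSpace ℝ d}
    (hr : IsSmooth r) (hθ : IsSmooth θ) (hw : IsSmooth w) (ha : IsSmooth a) (hc : IsSmooth c) (hd : IsSmooth d₃)
    {δ B : ℝ} (hbd : ∀ x, δ ≤ a x ∧ a x ≤ B ∧ δ ≤ c x ∧ c x ≤ B ∧ δ ≤ d₃ x ∧ d₃ x ≤ B) :
    δ * ((∫ x, r x ^ 2) + (∫ x, ‖w x‖ ^ 2) + ∫ x, θ x ^ 2) ≤ ∫ x, (a x * r x ^ 2 + c x * ‖w x‖ ^ 2 + d₃ x * θ x ^ 2) ∧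
    ∫ x, (a x * r x ^ 2 + c x * ‖w x‖ ^ 2 + d₃ x * θ x ^ 2) ≤ B * ((∫ x, r x ^ 2) + (∫ x, ‖w x‖ ^ 2) + ∫ x, θ x ^ 2) := by
  have hr2 : IsSmooth (fun x => r x ^ 2) := hr.pow 2
  have hw2 : IsSmooth (fun x => ‖w x‖ ^ 2) := hw.norm_sq
  have hθ2 : IsSmooth (fun x => θ x ^ 2) := hθ.pow 2
  have he : IsSmooth (fun x => a x * r x ^ 2 + c x * ‖w x‖ ^ 2 + d₃ x * θ x ^ 2) :=
    ((ha.mul hr2).add (hc.mul hw2)).add (hd.mul hθ2)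
  have hq : IsSmooth (fun x => r x ^ 2 + ‖w x‖ ^ 2 + θ x ^ 2) := (hr2.add hw2).add hθ2
  have i12 : Integrable (fun x => r x ^ 2 + ‖w x‖ ^ 2) volume := hr2.integrable.add hw2.integrable
  have esum : (∫ x, r x ^ 2) + (∫ x, ‖w x‖ ^ 2) + ∫ x, θ x ^ 2 = ∫ x, (r x ^ 2 + ‖w x‖ ^ 2 + θ x ^ 2) := by
    rw [integral_add i12 hθ2.integrable, integral_add hr2.integrable hw2.integrable]
  rw [esum, ← integral_const_mul, ← integral_const_mul]
  constructor
  · refine integral_mono (hq.integrable.const_mul δ) he.integrable fun x => ?_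
    obtain ⟨h1, -, h2, -, h3, -⟩ := hbd x
    have := sq_nonneg (r x); have := sq_nonneg ‖w x‖; have := sq_nonneg (θ x)
    simp only
    nlinarith
  · refine integral_mono he.integrable (hq.integrable.const_mul B) fun x => ?_
    obtain ⟨-, h1, -, h2, -, h3⟩ := hbd x
    have := sq_nonneg (r x); have := sq_nonneg ‖w x‖; have := sq_nonneg (θ x)
    simp only
    nlinarith

end Energies

/-! ## Integrated sizes against the Sobolev energy on `𝕋³` -/

section Sizes

variable {ρ ϑ : UnitAddTorus (Fin 3) → ℝ} {u : UnitAddTorus (Fin 3) → EuclideanSpace ℝ (Fin 3)}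

/-- The total second-derivative size `s₂ = dsize₂ ρ + vsize₂ u + dsize₂ ϑ`. [folklore] -/
def totSize₂ (ρ : UnitAddTorus (Fin 3) → ℝ) (u : UnitAddTorus (Fin 3) → EuclideanSpace ℝ (Fin 3))
    (ϑ : UnitAddTorus (Fin 3) → ℝ) (x : UnitAddTorus (Fin 3)) : ℝ :=
  dsize₂ ρ x + vsize₂ u x + dsize₂ ϑ x

/-- The total third-derivative size. [folklore] -/
def totSize₃ (ρ : UnitAddTorus (Fin 3) → ℝ) (u : UnitAddTorus (Fin 3) → EuclideanSpace ℝ (Fin 3))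
    (ϑ : UnitAddTorus (Fin 3) → ℝ) (x : UnitAddTorus (Fin 3)) : ℝ :=
  dsize₃ ρ x + vsize₃ u x + dsize₃ ϑ x

/-- `s₂ ≥ 0`. [folklore] -/
theorem totSize₂_nonneg (x : UnitAddTorus (Fin 3)) : 0 ≤ totSize₂ ρ u ϑ x := by
  unfold totSize₂
  have := dsize₂_nonneg ρ x; have := vsize₂_nonneg u x; have := dsize₂_nonneg ϑ x
  positivity

/-- `s₃ ≥ 0`. [folklore] -/
theorem totSize₃_nonneg (x : UnitAddTorus (Fin 3)) : 0 ≤ totSize₃ ρ u ϑ x := by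
  unfold totSize₃
  have := dsize₃_nonneg ρ x; have := vsize₃_nonneg u x; have := dsize₃_nonneg ϑ x
  positivity

/-- Continuity of `s₂`. [folklore] -/
theorem continuous_totSize₂ (hρ : IsSmooth ρ) (hu : IsSmooth u) (hϑ : IsSmooth ϑ) : Continuous (totSize₂ ρ u ϑ) := by
  unfold totSize₂ dsize₂ vsize₂
  refine ((continuous_finsetSum _ fun i _ => continuous_finsetSum _ fun j _ => ?_).add
    (continuous_finsetSum _ fun i _ => continuous_finsetSum _ fun j _ => ?_)).add
    (continuous_finsetSum _ fun i _ => continuous_finsetSum _ fun j _ => ?_)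
  · exact ((hρ.partialDeriv i).partialDeriv j).continuous.abs
  · exact ((hu.partialDeriv i).partialDeriv j).continuous.norm
  · exact ((hϑ.partialDeriv i).partialDeriv j).continuous.abs

/-- Continuity of `s₃`. [folklore] -/
theorem continuous_totSize₃ (hρ : IsSmooth ρ) (hu : IsSmooth u) (hϑ : IsSmooth ϑ) : Continuous (totSize₃ ρ u ϑ) := by
  unfold totSize₃ dsize₃ vsize₃
  refine ((continuous_finsetSum _ fun i _ => continuous_finsetSum _ fun j _ =>
      continuous_finsetSum _ fun k _ => ?_).add
    (continuous_finsetSum _ fun i _ => continuous_finsetSum _ fun j _ => continuous_finsetSum _ fun k _ => ?_)).add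
    (continuous_finsetSum _ fun i _ => continuous_finsetSum _ fun j _ => continuous_finsetSum _ fun k _ => ?_)
  · exact (((hρ.partialDeriv i).partialDeriv j).partialDeriv k).continuous.abs
  · exact (((hu.partialDeriv i).partialDeriv j).partialDeriv k).continuous.norm
  · exact (((hϑ.partialDeriv i).partialDeriv j).partialDeriv k).continuous.abs

/-- **`∫ s₂² + ∫ s₃² + ∫ s₂⁴ ≤ (108 + 2·10⁷ M²) E₃`** (with `|∂ρ|, ‖∂u‖, |∂ϑ| ≤ M`): the `L²`
conversions of `CompressibleEulerEnergySizes` on `𝕋³`. [cite: Majda1984, Ch. 2 §2.1 Prop. 2.1] -/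
theorem integral_sizes_le (hρ : IsSmooth ρ) (hu : IsSmooth u) (hϑ : IsSmooth ϑ) {M : ℝ}
    (hM : ∀ x i, |partialDeriv i ρ x| ≤ M ∧ ‖partialDeriv i u x‖ ≤ M ∧ |partialDeriv i ϑ x| ≤ M) :
    (∫ x, totSize₂ ρ u ϑ x ^ 2) + (∫ x, totSize₃ ρ u ϑ x ^ 2) + ∫ x, totSize₂ ρ u ϑ x ^ 4 ≤
      (108 + 20000000 * M ^ 2) * sobolevEnergy₃ ρ u ϑ := by
  -- continuity / integrability of the pieces
  have cρ2 : Continuous (dsize₂ ρ) := by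
    unfold dsize₂; exact continuous_finsetSum _ fun i _ => continuous_finsetSum _ fun j _ =>
      ((hρ.partialDeriv i).partialDeriv j).continuous.abs
  have cϑ2 : Continuous (dsize₂ ϑ) := by
    unfold dsize₂; exact continuous_finsetSum _ fun i _ => continuous_finsetSum _ fun j _ =>
      ((hϑ.partialDeriv i).partialDeriv j).continuous.abs
  have cu2 : Continuous (vsize₂ u) := by
    unfold vsize₂; exact continuous_finsetSum _ fun i _ => continuous_finsetSum _ fun j _ =>
      ((hu.partialDeriv i).partialDeriv j).continuous.norm
  have cρ3 : Continuous (dsize₃ ρ) := by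
    unfold dsize₃; exact continuous_finsetSum _ fun i _ => continuous_finsetSum _ fun j _ =>
      continuous_finsetSum _ fun k _ => (((hρ.partialDeriv i).partialDeriv j).partialDeriv k).continuous.abs
  have cϑ3 : Continuous (dsize₃ ϑ) := by
    unfold dsize₃; exact continuous_finsetSum _ fun i _ => continuous_finsetSum _ fun j _ =>
      continuous_finsetSum _ fun k _ => (((hϑ.partialDeriv i).partialDeriv j).partialDeriv k).continuous.abs
  have cu3 : Continuous (vsize₃ u) := by
    unfold vsize₃; exact continuous_finsetSum _ fun i _ => continuous_finsetSum _ fun j _ =>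
      continuous_finsetSum _ fun k _ => (((hu.partialDeriv i).partialDeriv j).partialDeriv k).continuous.norm
  have ci : ∀ {f : UnitAddTorus (Fin 3) → ℝ}, Continuous f → Integrable f volume := fun hf =>
    hf.integrable_of_hasCompactSupport (HasCompactSupport.of_compactSpace _)
  have iρ2 : Integrable (fun x => dsize₂ ρ x ^ 2) volume := ci (cρ2.pow 2)
  have iu2 : Integrable (fun x => vsize₂ u x ^ 2) volume := ci (cu2.pow 2)
  have iϑ2 : Integrable (fun x => dsize₂ ϑ x ^ 2) volume := ci (cϑ2.pow 2)
  have iρ3 : Integrable (fun x => dsize₃ ρ x ^ 2) volume := ci (cρ3.pow 2)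
  have iu3 : Integrable (fun x => vsize₃ u x ^ 2) volume := ci (cu3.pow 2)
  have iϑ3 : Integrable (fun x => dsize₃ ϑ x ^ 2) volume := ci (cϑ3.pow 2)
  have iρ4 : Integrable (fun x => dsize₂ ρ x ^ 4) volume := ci (cρ2.pow 4)
  have iu4 : Integrable (fun x => vsize₂ u x ^ 4) volume := ci (cu2.pow 4)
  have iϑ4 : Integrable (fun x => dsize₂ ϑ x ^ 4) volume := ci (cϑ2.pow 4)
  have it2 : Integrable (fun x => totSize₂ ρ u ϑ x ^ 2) volume := ci ((continuous_totSize₂ hρ hu hϑ).pow 2)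
  have it3 : Integrable (fun x => totSize₃ ρ u ϑ x ^ 2) volume := ci ((continuous_totSize₃ hρ hu hϑ).pow 2)
  have it4 : Integrable (fun x => totSize₂ ρ u ϑ x ^ 4) volume := ci ((continuous_totSize₂ hρ hu hϑ).pow 4)
  -- pointwise power-mean inequalities for three summands
  have p2 : ∀ x, totSize₂ ρ u ϑ x ^ 2 ≤ 3 * (dsize₂ ρ x ^ 2 + vsize₂ u x ^ 2 + dsize₂ ϑ x ^ 2) := fun x => by
    unfold totSize₂
    nlinarith [sq_nonneg (dsize₂ ρ x - vsize₂ u x), sq_nonneg (dsize₂ ρ x - dsize₂ ϑ x),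
      sq_nonneg (vsize₂ u x - dsize₂ ϑ x)]
  have p3 : ∀ x, totSize₃ ρ u ϑ x ^ 2 ≤ 3 * (dsize₃ ρ x ^ 2 + vsize₃ u x ^ 2 + dsize₃ ϑ x ^ 2) := fun x => by
    unfold totSize₃
    nlinarith [sq_nonneg (dsize₃ ρ x - vsize₃ u x), sq_nonneg (dsize₃ ρ x - dsize₃ ϑ x),
      sq_nonneg (vsize₃ u x - dsize₃ ϑ x)]
  have p4 : ∀ x, totSize₂ ρ u ϑ x ^ 4 ≤ 27 * (dsize₂ ρ x ^ 4 + vsize₂ u x ^ 4 + dsize₂ ϑ x ^ 4) := fun x => by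
    unfold totSize₂
    set a := dsize₂ ρ x; set b := vsize₂ u x; set c := dsize₂ ϑ x
    have h1 : (a + b + c) ^ 2 ≤ 3 * (a ^ 2 + b ^ 2 + c ^ 2) := by
      nlinarith [sq_nonneg (a - b), sq_nonneg (a - c), sq_nonneg (b - c)]
    have h2 : (a ^ 2 + b ^ 2 + c ^ 2) ^ 2 ≤ 3 * (a ^ 4 + b ^ 4 + c ^ 4) := by
      nlinarith [sq_nonneg (a ^ 2 - b ^ 2), sq_nonneg (a ^ 2 - c ^ 2), sq_nonneg (b ^ 2 - c ^ 2)]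
    have h0 : 0 ≤ (a + b + c) ^ 2 := sq_nonneg _
    calc (a + b + c) ^ 4 = ((a + b + c) ^ 2) ^ 2 := by ring
      _ ≤ (3 * (a ^ 2 + b ^ 2 + c ^ 2)) ^ 2 := pow_le_pow_left₀ h0 h1 2
      _ = 9 * (a ^ 2 + b ^ 2 + c ^ 2) ^ 2 := by ring
      _ ≤ 27 * (a ^ 4 + b ^ 4 + c ^ 4) := by linarith
  -- integrate
  have hM' : ∀ x i, |partialDeriv i ρ x| ≤ M := fun x i => (hM x i).1
  have hMu : ∀ x i, ‖partialDeriv i u x‖ ≤ M := fun x i => (hM x i).2.1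
  have hMϑ : ∀ x i, |partialDeriv i ϑ x| ≤ M := fun x i => (hM x i).2.2
  have I2 : ∫ x, totSize₂ ρ u ϑ x ^ 2 ≤ 27 * en₂ ρ u ϑ := by
    have h1 := integral_dsize₂_sq_le hρ; have h2 := integral_vsize₂_sq_le hu; have h3 := integral_dsize₂_sq_le hϑ
    simp only [Fintype.card_fin, Nat.cast_ofNat] at h1 h2 h3
    have i12 : Integrable (fun x => dsize₂ ρ x ^ 2 + vsize₂ u x ^ 2) volume := iρ2.add iu2
    have i123 : Integrable (fun x => dsize₂ ρ x ^ 2 + vsize₂ u x ^ 2 + dsize₂ ϑ x ^ 2) volume := i12.add iϑ2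
    calc ∫ x, totSize₂ ρ u ϑ x ^ 2 ≤ ∫ x, 3 * (dsize₂ ρ x ^ 2 + vsize₂ u x ^ 2 + dsize₂ ϑ x ^ 2) :=
          integral_mono it2 (i123.const_mul 3) p2
      _ = 3 * ((∫ x, dsize₂ ρ x ^ 2) + (∫ x, vsize₂ u x ^ 2) + ∫ x, dsize₂ ϑ x ^ 2) := by
          rw [integral_const_mul, integral_add i12 iϑ2, integral_add iρ2 iu2]
      _ ≤ 3 * ((3 : ℝ) ^ 2 * hsq₂ ρ + (3 : ℝ) ^ 2 * vsq₂ u + (3 : ℝ) ^ 2 * hsq₂ ϑ) := by linarith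
      _ = 27 * en₂ ρ u ϑ := by rw [en₂_eq]; ring
  have I3 : ∫ x, totSize₃ ρ u ϑ x ^ 2 ≤ 81 * en₃ ρ u ϑ := by
    have h1 := integral_dsize₃_sq_le hρ; have h2 := integral_vsize₃_sq_le hu; have h3 := integral_dsize₃_sq_le hϑ
    simp only [Fintype.card_fin, Nat.cast_ofNat] at h1 h2 h3
    have i12 : Integrable (fun x => dsize₃ ρ x ^ 2 + vsize₃ u x ^ 2) volume := iρ3.add iu3
    have i123 : Integrable (fun x => dsize₃ ρ x ^ 2 + vsize₃ u x ^ 2 + dsize₃ ϑ x ^ 2) volume := i12.add iϑ3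
    calc ∫ x, totSize₃ ρ u ϑ x ^ 2 ≤ ∫ x, 3 * (dsize₃ ρ x ^ 2 + vsize₃ u x ^ 2 + dsize₃ ϑ x ^ 2) :=
          integral_mono it3 (i123.const_mul 3) p3
      _ = 3 * ((∫ x, dsize₃ ρ x ^ 2) + (∫ x, vsize₃ u x ^ 2) + ∫ x, dsize₃ ϑ x ^ 2) := by
          rw [integral_const_mul, integral_add i12 iϑ3, integral_add iρ3 iu3]
      _ ≤ 3 * ((3 : ℝ) ^ 3 * hsq₃ ρ + (3 : ℝ) ^ 3 * vsq₃ u + (3 : ℝ) ^ 3 * hsq₃ ϑ) := by linarith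
      _ = 81 * en₃ ρ u ϑ := by rw [en₃_eq]; ring
  have I4 : ∫ x, totSize₂ ρ u ϑ x ^ 4 ≤ 20000000 * M ^ 2 * en₃ ρ u ϑ := by
    have h1 := integral_dsize₂_pow_four_le hρ hM'
    have h2 := integral_vsize₂_pow_four_le hu hMu
    have h3 := integral_dsize₂_pow_four_le hϑ hMϑ
    simp only [Fintype.card_fin, Nat.cast_ofNat] at h1 h2 h3
    have i12 : Integrable (fun x => dsize₂ ρ x ^ 4 + vsize₂ u x ^ 4) volume := iρ4.add iu4
    have i123 : Integrable (fun x => dsize₂ ρ x ^ 4 + vsize₂ u x ^ 4 + dsize₂ ϑ x ^ 4) volume := i12.add iϑ4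
    have n1 := hsq₃_nonneg ρ; have n2 := vsq₃_nonneg u; have n3 := hsq₃_nonneg ϑ
    have hM2 : 0 ≤ M ^ 2 := sq_nonneg M
    calc ∫ x, totSize₂ ρ u ϑ x ^ 4 ≤ ∫ x, 27 * (dsize₂ ρ x ^ 4 + vsize₂ u x ^ 4 + dsize₂ ϑ x ^ 4) :=
          integral_mono it4 (i123.const_mul 27) p4
      _ = 27 * ((∫ x, dsize₂ ρ x ^ 4) + (∫ x, vsize₂ u x ^ 4) + ∫ x, dsize₂ ϑ x ^ 4) := by
          rw [integral_const_mul, integral_add i12 iϑ4, integral_add iρ4 iu4]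
      _ ≤ 27 * (9 * (3 : ℝ) ^ 6 * M ^ 2 * hsq₃ ρ + 9 * (3 : ℝ) ^ 9 * M ^ 2 * vsq₃ u + 9 * (3 : ℝ) ^ 6 * M ^ 2 * hsq₃ ϑ) := by
          linarith
      _ ≤ 20000000 * M ^ 2 * en₃ ρ u ϑ := by
          rw [en₃_eq]
          nlinarith [mul_nonneg hM2 n1, mul_nonneg hM2 n2, mul_nonneg hM2 n3]
  have e0 := en₀_nonneg ρ u ϑ; have e1 := en₁_nonneg ρ u ϑ; have e2 := en₂_nonneg ρ u ϑ; have e3 := en₃_nonneg ρ u ϑ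
  have hM2 : 0 ≤ M ^ 2 := sq_nonneg M
  unfold sobolevEnergy₃
  nlinarith [mul_nonneg hM2 e0, mul_nonneg hM2 e1, mul_nonneg hM2 e2, mul_nonneg hM2 e3]

end Sizes

/-! ## The slab setting -/

section Slab

variable {ζ f : ℝ → ℝ} {τ M C δ B : ℝ} {ρ ϑ : ℝ → UnitAddTorus (Fin 3) → ℝ}
  {u : ℝ → UnitAddTorus (Fin 3) → EuclideanSpace ℝ (Fin 3)}

/-- Hypothesis bundle for the energy estimate on a slab `[0, τ]`: a primitive solution of the
athermal monatomic Euler system with `C¹` bounds `M` and the uniform coefficient bounds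
`C, δ, B` of `exists_slab_bounds` (recorded pointwise). [cite: Majda1984, Ch. 2 §2.1, proof of Thm 2.2] -/
structure SlabHyp (ζ f : ℝ → ℝ) (τ M C δ B : ℝ) (ρ ϑ : ℝ → UnitAddTorus (Fin 3) → ℝ)
    (u : ℝ → UnitAddTorus (Fin 3) → EuclideanSpace ℝ (Fin 3)) : Prop where
  pos : 0 < τ
  zeta : ContDiff ℝ ∞ ζ
  sol : IsPrimitiveEulerSolutionOn (EulerEOS.monatomicExcess ζ f) (Icc 0 τ) ρ u ϑ
  M_nonneg : 0 ≤ M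
  one_le : 1 ≤ C
  δ_pos : 0 < δ
  B_nonneg : 0 ≤ B
  dbounds : ∀ s ∈ Icc 0 τ, ∀ x i,
    |partialDeriv i (ρ s) x| ≤ M ∧ ‖partialDeriv i (u s) x‖ ≤ M ∧ |partialDeriv i (ϑ s) x| ≤ M
  coef : ∀ s ∈ Icc 0 τ, ∀ x,
    (HasDerivBoundsAt₃ (coefA ζ ρ ϑ s) x C (dsize₂ (ρ s) x + dsize₂ (ϑ s) x) (dsize₃ (ρ s) x + dsize₃ (ϑ s) x) ∧
      HasDerivBoundsAt₃ (coefB ζ ρ s) x C (dsize₂ (ρ s) x + dsize₂ (ϑ s) x) (dsize₃ (ρ s) x + dsize₃ (ϑ s) x) ∧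
      HasDerivBoundsAt₃ (coefG ζ ρ ϑ s) x C (dsize₂ (ρ s) x + dsize₂ (ϑ s) x) (dsize₃ (ρ s) x + dsize₃ (ϑ s) x)) ∧
    (δ ≤ coefA ζ ρ ϑ s x ∧ coefA ζ ρ ϑ s x ≤ B ∧ δ ≤ ρ s x ∧ ρ s x ≤ B ∧ δ ≤ coefD ρ ϑ s x ∧ coefD ρ ϑ s x ≤ B) ∧
    (|timeDerivWithin (Icc 0 τ) (coefA ζ ρ ϑ) s x| ≤ B ∧ |timeDerivWithin (Icc 0 τ) ρ s x| ≤ B ∧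
      |timeDerivWithin (Icc 0 τ) (coefD ρ ϑ) s x| ≤ B) ∧
    (|divergence (fun y => coefA ζ ρ ϑ s y • u s y) x| ≤ B ∧ |divergence (fun y => ρ s y • u s y) x| ≤ B ∧
      |divergence (fun y => coefD ρ ϑ s y • u s y) x| ≤ B) ∧
    (∀ i, |partialDeriv i (fun y => coefA ζ ρ ϑ s y * ρ s y) x| ≤ B ∧
      |partialDeriv i (fun y => coefD ρ ϑ s y * coefG ζ ρ ϑ s y) x| ≤ B)

/-- The level function `1 + s₂ + s₃ + s₂²` at `(s, x)`. [folklore] -/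
def SlabHyp.lvl (_ : SlabHyp ζ f τ M C δ B ρ ϑ u) (s : ℝ) (x : UnitAddTorus (Fin 3)) : ℝ :=
  1 + totSize₂ (ρ s) (u s) (ϑ s) x + totSize₃ (ρ s) (u s) (ϑ s) x + totSize₂ (ρ s) (u s) (ϑ s) x * totSize₂ (ρ s) (u s) (ϑ s) x

/-- The common residual `L²` bound `Φ(s) = 36K²(1 + (108 + 2·10⁷M²) E₃(s))`. [folklore] -/
def SlabHyp.Phi (_ : SlabHyp ζ f τ M C δ B ρ ϑ u) (s : ℝ) : ℝ :=
  36 * levelConst (Fin 3) C M ^ 2 * (1 + (108 + 20000000 * M ^ 2) * sobolevEnergy₃ (ρ s) (u s) (ϑ s))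

namespace SlabHyp

variable (H : SlabHyp ζ f τ M C δ B ρ ϑ u)
include H

/-- The slab is a set of unique differentiability. [folklore] -/
theorem uniq : UniqueDiffOn ℝ (Icc 0 τ) := uniqueDiffOn_Icc H.pos

/-- `Φ ≥ 0`. [folklore] -/
theorem Phi_nonneg (s : ℝ) : 0 ≤ H.Phi s := by
  unfold SlabHyp.Phi
  have := sobolevEnergy₃_nonneg (ρ s) (u s) (ϑ s)
  have := levelConst_nonneg (d := Fin 3) C M
  have : 0 ≤ M ^ 2 := sq_nonneg M
  positivity

/-- The weight identity `d₃ g = ρ b` along the solution. [folklore] -/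
theorem weights {s : ℝ} (hs : s ∈ Icc 0 τ) (x : UnitAddTorus (Fin 3)) :
    coefD ρ ϑ s x * coefG ζ ρ ϑ s x = ρ s x * coefB ζ ρ s x :=
  coefD_mul_coefG (H.sol.temperature_pos s hs x).ne'

/-- The packaged sup bounds in the form consumed by `word_deriv_le`. [folklore] -/
theorem hbd {s : ℝ} (hs : s ∈ Icc 0 τ) (x : UnitAddTorus (Fin 3)) :
    0 ≤ coefA ζ ρ ϑ s x ∧ coefA ζ ρ ϑ s x ≤ B ∧ 0 ≤ ρ s x ∧ ρ s x ≤ B ∧ 0 ≤ coefD ρ ϑ s x ∧ coefD ρ ϑ s x ≤ B ∧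
    |timeDerivWithin (Icc 0 τ) (coefA ζ ρ ϑ) s x| ≤ B ∧ |timeDerivWithin (Icc 0 τ) ρ s x| ≤ B ∧
    |timeDerivWithin (Icc 0 τ) (coefD ρ ϑ) s x| ≤ B ∧
    |divergence (fun y => coefA ζ ρ ϑ s y • u s y) x| ≤ B ∧ |divergence (fun y => ρ s y • u s y) x| ≤ B ∧
    |divergence (fun y => coefD ρ ϑ s y • u s y) x| ≤ B ∧
    ∀ i, |partialDeriv i (fun y => coefA ζ ρ ϑ s y * ρ s y) x| ≤ B ∧
      |partialDeriv i (fun y => coefD ρ ϑ s y * coefG ζ ρ ϑ s y) x| ≤ B := by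
  obtain ⟨-, ⟨a1, a2, a3, a4, a5, a6⟩, ⟨t1, t2, t3⟩, ⟨d1, d2, d3⟩, hp⟩ := H.coef s hs x
  have hδ := H.δ_pos.le
  exact ⟨hδ.trans a1, a2, hδ.trans a3, a4, hδ.trans a5, a6, t1, t2, t3, d1, d2, d3, hp⟩

/-- The weight bounds `δ ≤ a, ρ, d₃ ≤ B` at a time slice. [folklore] -/
theorem wbd {s : ℝ} (hs : s ∈ Icc 0 τ) (x : UnitAddTorus (Fin 3)) :
    δ ≤ coefA ζ ρ ϑ s x ∧ coefA ζ ρ ϑ s x ≤ B ∧ δ ≤ ρ s x ∧ ρ s x ≤ B ∧ δ ≤ coefD ρ ϑ s x ∧ coefD ρ ϑ s x ≤ B :=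
  (H.coef s hs x).2.1

/-- The hypotheses of the level lemmas at `(s, x)`: the coefficient bounds relative to the TOTAL
sizes. [folklore] -/
theorem coefAt {s : ℝ} (hs : s ∈ Icc 0 τ) (x : UnitAddTorus (Fin 3)) :
    HasDerivBoundsAt₃ (coefA ζ ρ ϑ s) x C (totSize₂ (ρ s) (u s) (ϑ s) x) (totSize₃ (ρ s) (u s) (ϑ s) x) ∧
    HasDerivBoundsAt₃ (coefB ζ ρ s) x C (totSize₂ (ρ s) (u s) (ϑ s) x) (totSize₃ (ρ s) (u s) (ϑ s) x) ∧
    HasDerivBoundsAt₃ (coefG ζ ρ ϑ s) x C (totSize₂ (ρ s) (u s) (ϑ s) x) (totSize₃ (ρ s) (u s) (ϑ s) x) := by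
  obtain ⟨⟨ha, hb, hg⟩, -, -, -, -⟩ := H.coef s hs x
  have h2 : dsize₂ (ρ s) x + dsize₂ (ϑ s) x ≤ totSize₂ (ρ s) (u s) (ϑ s) x := by
    unfold totSize₂; linarith [vsize₂_nonneg (u s) x]
  have h3 : dsize₃ (ρ s) x + dsize₃ (ϑ s) x ≤ totSize₃ (ρ s) (u s) (ϑ s) x := by
    unfold totSize₃; linarith [vsize₃_nonneg (u s) x]
  exact ⟨ha.mono_size h2 h3, hb.mono_size h2 h3, hg.mono_size h2 h3⟩

/-! ### Pointwise residual bounds, all levels: `|P| ≤ 3K · lvl` -/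

/-- `lvl ≥ 1`, `lvl ≥ 1 + s₂`, and its defining formula. [folklore] -/
theorem lvl_ge {s : ℝ} (x : UnitAddTorus (Fin 3)) :
    1 ≤ H.lvl s x ∧ 1 + totSize₂ (ρ s) (u s) (ϑ s) x ≤ H.lvl s x ∧
    1 + totSize₂ (ρ s) (u s) (ϑ s) x + totSize₃ (ρ s) (u s) (ϑ s) x +
      totSize₂ (ρ s) (u s) (ϑ s) x * totSize₂ (ρ s) (u s) (ϑ s) x = H.lvl s x := by
  unfold SlabHyp.lvl
  have h2 := totSize₂_nonneg (ρ := ρ s) (u := u s) (ϑ := ϑ s) x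
  have h3 := totSize₃_nonneg (ρ := ρ s) (u := u s) (ϑ := ϑ s) x
  refine ⟨by nlinarith, by nlinarith, rfl⟩

/-- From the three level bounds `b₁ ≤ K`, `b₂ ≤ K(1+s₂)` (two pieces), `b₃ ≤ K(1+s₂+s₃+s₂²)`
(three pieces) to the common bound `3K · lvl`. [folklore] -/
theorem three_pieces {s : ℝ} (x : UnitAddTorus (Fin 3)) {p₁ p₂ p₃ : ℝ}
    (h₁ : p₁ ≤ levelConst (Fin 3) C M * (1 + totSize₂ (ρ s) (u s) (ϑ s) x + totSize₃ (ρ s) (u s) (ϑ s) x +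
      totSize₂ (ρ s) (u s) (ϑ s) x * totSize₂ (ρ s) (u s) (ϑ s) x))
    (h₂ : p₂ ≤ levelConst (Fin 3) C M * (1 + totSize₂ (ρ s) (u s) (ϑ s) x + totSize₃ (ρ s) (u s) (ϑ s) x +
      totSize₂ (ρ s) (u s) (ϑ s) x * totSize₂ (ρ s) (u s) (ϑ s) x))
    (h₃ : p₃ ≤ levelConst (Fin 3) C M * (1 + totSize₂ (ρ s) (u s) (ϑ s) x + totSize₃ (ρ s) (u s) (ϑ s) x +
      totSize₂ (ρ s) (u s) (ϑ s) x * totSize₂ (ρ s) (u s) (ϑ s) x)) :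
    p₁ + p₂ + p₃ ≤ 3 * levelConst (Fin 3) C M * H.lvl s x := by
  obtain ⟨-, -, l3⟩ := H.lvl_ge (s := s) x
  rw [← l3]; linarith

omit H in
/-- Upgrading a level-1 or level-2 bound to the level-3 form. [folklore] -/
theorem upgrade {s : ℝ} (x : UnitAddTorus (Fin 3)) {p : ℝ}
    (h : p ≤ levelConst (Fin 3) C M ∨ p ≤ levelConst (Fin 3) C M * (1 + totSize₂ (ρ s) (u s) (ϑ s) x)) :
    p ≤ levelConst (Fin 3) C M * (1 + totSize₂ (ρ s) (u s) (ϑ s) x + totSize₃ (ρ s) (u s) (ϑ s) x +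
      totSize₂ (ρ s) (u s) (ϑ s) x * totSize₂ (ρ s) (u s) (ϑ s) x) := by
  have hK := levelConst_nonneg (d := Fin 3) C M
  have h2 := totSize₂_nonneg (ρ := ρ s) (u := u s) (ϑ := ϑ s) x
  have h3 := totSize₃_nonneg (ρ := ρ s) (u := u s) (ϑ := ϑ s) x
  have h22 : 0 ≤ totSize₂ (ρ s) (u s) (ϑ s) x * totSize₂ (ρ s) (u s) (ϑ s) x := mul_nonneg h2 h2
  rcases h with h | h
  · nlinarith
  · nlinarith

/-- Continuity residuals, levels 1–3. [cite: Majda1984, Ch. 2 §2.1, proof of Thm 2.2] -/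
theorem cont_bounds {s : ℝ} (hs : s ∈ Icc 0 τ) (j k l : Fin 3) (x : UnitAddTorus (Fin 3)) :
    |(-tcont (u s) (ρ s) (ρ s) (u s) j x)| ≤ 3 * levelConst (Fin 3) C M * H.lvl s x ∧
    |(-(partialDeriv k (tcont (u s) (ρ s) (ρ s) (u s) j) x) -
        tcont (u s) (ρ s) (partialDeriv j (ρ s)) (partialDeriv j (u s)) k x)| ≤ 3 * levelConst (Fin 3) C M * H.lvl s x ∧
    |(-(partialDeriv l (partialDeriv k (tcont (u s) (ρ s) (ρ s) (u s) j)) x) -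
        partialDeriv l (tcont (u s) (ρ s) (partialDeriv j (ρ s)) (partialDeriv j (u s)) k) x -
        tcont (u s) (ρ s) (partialDeriv k (partialDeriv j (ρ s))) (partialDeriv k (partialDeriv j (u s))) l x)| ≤
      3 * levelConst (Fin 3) C M * H.lvl s x := by
  have hρs := H.sol.smooth_density.isSmooth_slice hs
  have hus := H.sol.smooth_velocity.isSmooth_slice hs
  have hMx := H.dbounds s hs x
  have b1 := cont_level₁ (hu := hus) (hM0 := H.M_nonneg) (hC := H.one_le) (hM := hMx)
    (hs₂ := le_refl (totSize₂ (ρ s) (u s) (ϑ s) x)) (hs₃ := le_refl (totSize₃ (ρ s) (u s) (ϑ s) x)) j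
  obtain ⟨b2a, b2b⟩ := cont_level₂ (hρ := hρs) (hu := hus) (hM0 := H.M_nonneg) (hC := H.one_le) (hM := hMx)
    (hs₂ := le_refl (totSize₂ (ρ s) (u s) (ϑ s) x)) (hs₃ := le_refl (totSize₃ (ρ s) (u s) (ϑ s) x)) j k
  obtain ⟨b3a, b3b, b3c⟩ := cont_level₃ (hρ := hρs) (hu := hus) (hM0 := H.M_nonneg) (hC := H.one_le) (hM := hMx)
    (hs₂ := le_refl (totSize₂ (ρ s) (u s) (ϑ s) x)) (hs₃ := le_refl (totSize₃ (ρ s) (u s) (ϑ s) x)) j k l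
  refine ⟨?_, ?_, ?_⟩
  · rw [abs_neg]
    have h := H.three_pieces (s := s) x
      (upgrade x (Or.inl b1)) (upgrade x (Or.inl b1)) (upgrade x (Or.inl b1))
    linarith [abs_nonneg (tcont (u s) (ρ s) (ρ s) (u s) j x)]
  · have h := H.three_pieces (s := s) x
      (upgrade x (Or.inr b2a)) (upgrade x (Or.inr b2b)) (upgrade x (Or.inr b2b))
    calc _ ≤ |(-(partialDeriv k (tcont (u s) (ρ s) (ρ s) (u s) j) x))| +
          |tcont (u s) (ρ s) (partialDeriv j (ρ s)) (partialDeriv j (u s)) k x| := abs_sub _ _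
      _ ≤ _ := by
          rw [abs_neg]; linarith [abs_nonneg (tcont (u s) (ρ s) (partialDeriv j (ρ s)) (partialDeriv j (u s)) k x)]
  · have h := H.three_pieces (s := s) x b3a b3b b3c
    calc _ ≤ |(-(partialDeriv l (partialDeriv k (tcont (u s) (ρ s) (ρ s) (u s) j)) x) -
          partialDeriv l (tcont (u s) (ρ s) (partialDeriv j (ρ s)) (partialDeriv j (u s)) k) x)| +
          |tcont (u s) (ρ s) (partialDeriv k (partialDeriv j (ρ s))) (partialDeriv k (partialDeriv j (u s))) l x| :=
          abs_sub _ _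
      _ ≤ |(-(partialDeriv l (partialDeriv k (tcont (u s) (ρ s) (ρ s) (u s) j)) x))| +
          |partialDeriv l (tcont (u s) (ρ s) (partialDeriv j (ρ s)) (partialDeriv j (u s)) k) x| +
          |tcont (u s) (ρ s) (partialDeriv k (partialDeriv j (ρ s))) (partialDeriv k (partialDeriv j (u s))) l x| := by
          linarith [abs_sub (-(partialDeriv l (partialDeriv k (tcont (u s) (ρ s) (ρ s) (u s) j)) x))
            (partialDeriv l (tcont (u s) (ρ s) (partialDeriv j (ρ s)) (partialDeriv j (u s)) k) x)]
      _ ≤ _ := by rw [abs_neg]; linarith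

/-- Momentum residuals, levels 1–3. [cite: Majda1984, Ch. 2 §2.1, proof of Thm 2.2] -/
theorem mom_bounds {s : ℝ} (hs : s ∈ Icc 0 τ) (j k l : Fin 3) (x : UnitAddTorus (Fin 3)) :
    ‖(-tmom (u s) (coefA ζ ρ ϑ s) (coefB ζ ρ s) (ρ s) (ϑ s) (u s) j x)‖ ≤ 3 * levelConst (Fin 3) C M * H.lvl s x ∧
    ‖(-(partialDeriv k (tmom (u s) (coefA ζ ρ ϑ s) (coefB ζ ρ s) (ρ s) (ϑ s) (u s) j) x) -
        tmom (u s) (coefA ζ ρ ϑ s) (coefB ζ ρ s) (partialDeriv j (ρ s)) (partialDeriv j (ϑ s))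
          (partialDeriv j (u s)) k x)‖ ≤ 3 * levelConst (Fin 3) C M * H.lvl s x ∧
    ‖(-(partialDeriv l (partialDeriv k (tmom (u s) (coefA ζ ρ ϑ s) (coefB ζ ρ s) (ρ s) (ϑ s) (u s) j)) x) -
        partialDeriv l (tmom (u s) (coefA ζ ρ ϑ s) (coefB ζ ρ s) (partialDeriv j (ρ s)) (partialDeriv j (ϑ s))
          (partialDeriv j (u s)) k) x -
        tmom (u s) (coefA ζ ρ ϑ s) (coefB ζ ρ s) (partialDeriv k (partialDeriv j (ρ s)))
          (partialDeriv k (partialDeriv j (ϑ s))) (partialDeriv k (partialDeriv j (u s))) l x)‖ ≤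
      3 * levelConst (Fin 3) C M * H.lvl s x := by
  have hρs := H.sol.smooth_density.isSmooth_slice hs
  have hus := H.sol.smooth_velocity.isSmooth_slice hs
  have hϑs := H.sol.smooth_temperature.isSmooth_slice hs
  have hAs : IsSmooth (coefA ζ ρ ϑ s) := (isSmoothSpaceTimeOn_coefA H.zeta H.sol).isSmooth_slice hs
  have hBs : IsSmooth (coefB ζ ρ s) := (isSmoothSpaceTimeOn_coefB H.zeta H.sol).isSmooth_slice hs
  have hMx := H.dbounds s hs x
  obtain ⟨Ha, Hb, -⟩ := H.coefAt hs x
  have b1 := mom_level₁ (hρ := hρs) (hϑ := hϑs) (hM0 := H.M_nonneg) (hC := H.one_le) (hM := hMx)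
    (hs₂ := le_refl (totSize₂ (ρ s) (u s) (ϑ s) x)) (hs₃ := le_refl (totSize₃ (ρ s) (u s) (ϑ s) x)) (Ha := Ha)
    (Hb := Hb) j
  obtain ⟨b2a, b2b⟩ := mom_level₂ (hρ := hρs) (hu := hus) (hϑ := hϑs) (ha := hAs) (hb := hBs) (hM0 := H.M_nonneg)
    (hC := H.one_le) (hM := hMx) (hs₂ := le_refl (totSize₂ (ρ s) (u s) (ϑ s) x))
    (hs₃ := le_refl (totSize₃ (ρ s) (u s) (ϑ s) x)) (Ha := Ha) (Hb := Hb) j k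
  obtain ⟨b3a, b3b, b3c⟩ := mom_level₃ (hρ := hρs) (hu := hus) (hϑ := hϑs) (ha := hAs) (hb := hBs)
    (hM0 := H.M_nonneg) (hC := H.one_le) (hM := hMx) (hs₂ := le_refl (totSize₂ (ρ s) (u s) (ϑ s) x))
    (hs₃ := le_refl (totSize₃ (ρ s) (u s) (ϑ s) x)) (Ha := Ha) (Hb := Hb) j k l
  refine ⟨?_, ?_, ?_⟩
  · rw [norm_neg]
    have h := H.three_pieces (s := s) x (upgrade x (Or.inl b1)) (upgrade x (Or.inl b1)) (upgrade x (Or.inl b1))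
    linarith [norm_nonneg (tmom (u s) (coefA ζ ρ ϑ s) (coefB ζ ρ s) (ρ s) (ϑ s) (u s) j x)]
  · have h := H.three_pieces (s := s) x (upgrade x (Or.inr b2a)) (upgrade x (Or.inr b2b)) (upgrade x (Or.inr b2b))
    calc _ ≤ ‖(-(partialDeriv k (tmom (u s) (coefA ζ ρ ϑ s) (coefB ζ ρ s) (ρ s) (ϑ s) (u s) j) x))‖ +
          ‖tmom (u s) (coefA ζ ρ ϑ s) (coefB ζ ρ s) (partialDeriv j (ρ s)) (partialDeriv j (ϑ s))
            (partialDeriv j (u s)) k x‖ := norm_sub_le _ _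
      _ ≤ _ := by
          rw [norm_neg]
          linarith [norm_nonneg (tmom (u s) (coefA ζ ρ ϑ s) (coefB ζ ρ s) (partialDeriv j (ρ s))
            (partialDeriv j (ϑ s)) (partialDeriv j (u s)) k x)]
  · have h := H.three_pieces (s := s) x b3a b3b b3c
    calc _ ≤ ‖(-(partialDeriv l (partialDeriv k (tmom (u s) (coefA ζ ρ ϑ s) (coefB ζ ρ s) (ρ s) (ϑ s) (u s) j)) x) -
          partialDeriv l (tmom (u s) (coefA ζ ρ ϑ s) (coefB ζ ρ s) (partialDeriv j (ρ s)) (partialDeriv j (ϑ s))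
            (partialDeriv j (u s)) k) x)‖ +
          ‖tmom (u s) (coefA ζ ρ ϑ s) (coefB ζ ρ s) (partialDeriv k (partialDeriv j (ρ s)))
            (partialDeriv k (partialDeriv j (ϑ s))) (partialDeriv k (partialDeriv j (u s))) l x‖ := norm_sub_le _ _
      _ ≤ ‖(-(partialDeriv l (partialDeriv k (tmom (u s) (coefA ζ ρ ϑ s) (coefB ζ ρ s) (ρ s) (ϑ s) (u s) j)) x))‖ +
          ‖partialDeriv l (tmom (u s) (coefA ζ ρ ϑ s) (coefB ζ ρ s) (partialDeriv j (ρ s)) (partialDeriv j (ϑ s))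
            (partialDeriv j (u s)) k) x‖ +
          ‖tmom (u s) (coefA ζ ρ ϑ s) (coefB ζ ρ s) (partialDeriv k (partialDeriv j (ρ s)))
            (partialDeriv k (partialDeriv j (ϑ s))) (partialDeriv k (partialDeriv j (u s))) l x‖ := by
          linarith [norm_sub_le (-(partialDeriv l (partialDeriv k (tmom (u s) (coefA ζ ρ ϑ s) (coefB ζ ρ s)
            (ρ s) (ϑ s) (u s) j)) x))
            (partialDeriv l (tmom (u s) (coefA ζ ρ ϑ s) (coefB ζ ρ s) (partialDeriv j (ρ s)) (partialDeriv j (ϑ s))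
              (partialDeriv j (u s)) k) x)]
      _ ≤ _ := by rw [norm_neg]; linarith

/-- Temperature residuals, levels 1–3. [cite: Majda1984, Ch. 2 §2.1, proof of Thm 2.2] -/
theorem temp_bounds {s : ℝ} (hs : s ∈ Icc 0 τ) (j k l : Fin 3) (x : UnitAddTorus (Fin 3)) :
    |(-tcont (u s) (coefG ζ ρ ϑ s) (ϑ s) (u s) j x)| ≤ 3 * levelConst (Fin 3) C M * H.lvl s x ∧
    |(-(partialDeriv k (tcont (u s) (coefG ζ ρ ϑ s) (ϑ s) (u s) j) x) -
        tcont (u s) (coefG ζ ρ ϑ s) (partialDeriv j (ϑ s)) (partialDeriv j (u s)) k x)| ≤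
      3 * levelConst (Fin 3) C M * H.lvl s x ∧
    |(-(partialDeriv l (partialDeriv k (tcont (u s) (coefG ζ ρ ϑ s) (ϑ s) (u s) j)) x) -
        partialDeriv l (tcont (u s) (coefG ζ ρ ϑ s) (partialDeriv j (ϑ s)) (partialDeriv j (u s)) k) x -
        tcont (u s) (coefG ζ ρ ϑ s) (partialDeriv k (partialDeriv j (ϑ s))) (partialDeriv k (partialDeriv j (u s))) l x)| ≤
      3 * levelConst (Fin 3) C M * H.lvl s x := by
  have hus := H.sol.smooth_velocity.isSmooth_slice hs
  have hϑs := H.sol.smooth_temperature.isSmooth_slice hs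
  have hGs : IsSmooth (coefG ζ ρ ϑ s) := (isSmoothSpaceTimeOn_coefG H.zeta H.sol).isSmooth_slice hs
  have hMx := H.dbounds s hs x
  obtain ⟨-, -, Hg⟩ := H.coefAt hs x
  have b1 := temp_level₁ (hu := hus) (hM0 := H.M_nonneg) (hC := H.one_le) (hM := hMx)
    (hs₂ := le_refl (totSize₂ (ρ s) (u s) (ϑ s) x)) (hs₃ := le_refl (totSize₃ (ρ s) (u s) (ϑ s) x)) (Hg := Hg) j
  obtain ⟨b2a, b2b⟩ := temp_level₂ (hu := hus) (hϑ := hϑs) (hg := hGs) (hM0 := H.M_nonneg) (hC := H.one_le)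
    (hM := hMx) (hs₂ := le_refl (totSize₂ (ρ s) (u s) (ϑ s) x)) (hs₃ := le_refl (totSize₃ (ρ s) (u s) (ϑ s) x))
    (Hg := Hg) j k
  obtain ⟨b3a, b3b, b3c⟩ := temp_level₃ (hu := hus) (hϑ := hϑs) (hg := hGs) (hM0 := H.M_nonneg) (hC := H.one_le)
    (hM := hMx) (hs₂ := le_refl (totSize₂ (ρ s) (u s) (ϑ s) x)) (hs₃ := le_refl (totSize₃ (ρ s) (u s) (ϑ s) x))
    (Hg := Hg) j k l
  refine ⟨?_, ?_, ?_⟩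
  · rw [abs_neg]
    have h := H.three_pieces (s := s) x (upgrade x (Or.inl b1)) (upgrade x (Or.inl b1)) (upgrade x (Or.inl b1))
    linarith [abs_nonneg (tcont (u s) (coefG ζ ρ ϑ s) (ϑ s) (u s) j x)]
  · have h := H.three_pieces (s := s) x (upgrade x (Or.inr b2a)) (upgrade x (Or.inr b2b)) (upgrade x (Or.inr b2b))
    calc _ ≤ |(-(partialDeriv k (tcont (u s) (coefG ζ ρ ϑ s) (ϑ s) (u s) j) x))| +
          |tcont (u s) (coefG ζ ρ ϑ s) (partialDeriv j (ϑ s)) (partialDeriv j (u s)) k x| := abs_sub _ _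
      _ ≤ _ := by
          rw [abs_neg]
          linarith [abs_nonneg (tcont (u s) (coefG ζ ρ ϑ s) (partialDeriv j (ϑ s)) (partialDeriv j (u s)) k x)]
  · have h := H.three_pieces (s := s) x b3a b3b b3c
    calc _ ≤ |(-(partialDeriv l (partialDeriv k (tcont (u s) (coefG ζ ρ ϑ s) (ϑ s) (u s) j)) x) -
          partialDeriv l (tcont (u s) (coefG ζ ρ ϑ s) (partialDeriv j (ϑ s)) (partialDeriv j (u s)) k) x)| +
          |tcont (u s) (coefG ζ ρ ϑ s) (partialDeriv k (partialDeriv j (ϑ s))) (partialDeriv k (partialDeriv j (u s))) l x| :=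
          abs_sub _ _
      _ ≤ |(-(partialDeriv l (partialDeriv k (tcont (u s) (coefG ζ ρ ϑ s) (ϑ s) (u s) j)) x))| +
          |partialDeriv l (tcont (u s) (coefG ζ ρ ϑ s) (partialDeriv j (ϑ s)) (partialDeriv j (u s)) k) x| +
          |tcont (u s) (coefG ζ ρ ϑ s) (partialDeriv k (partialDeriv j (ϑ s))) (partialDeriv k (partialDeriv j (u s))) l x| := by
          linarith [abs_sub (-(partialDeriv l (partialDeriv k (tcont (u s) (coefG ζ ρ ϑ s) (ϑ s) (u s) j)) x))
            (partialDeriv l (tcont (u s) (coefG ζ ρ ϑ s) (partialDeriv j (ϑ s)) (partialDeriv j (u s)) k) x)]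
      _ ≤ _ := by rw [abs_neg]; linarith

/-! ### `L²` conversion of the pointwise bounds -/

/-- `∫ P² ≤ Φ(s)` for a continuous `P` with `|P| ≤ 3K · lvl`. [cite: Majda1984, Ch. 2 §2.1, proof of Thm 2.2] -/
theorem integral_sq_le_Phi {s : ℝ} (hs : s ∈ Icc 0 τ) {P : UnitAddTorus (Fin 3) → ℝ} (hP : Continuous P)
    (hb : ∀ x, |P x| ≤ 3 * levelConst (Fin 3) C M * H.lvl s x) : ∫ x, P x ^ 2 ≤ H.Phi s := by
  have hρs := H.sol.smooth_density.isSmooth_slice hs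
  have hus := H.sol.smooth_velocity.isSmooth_slice hs
  have hϑs := H.sol.smooth_temperature.isSmooth_slice hs
  have hK := levelConst_nonneg (d := Fin 3) C M
  have h1 := integral_sq_le_of_pointwise hP (continuous_totSize₂ hρs hus hϑs) (continuous_totSize₃ hρs hus hϑs)
    (fun x => totSize₂_nonneg x) (fun x => totSize₃_nonneg x) (K := 3 * levelConst (Fin 3) C M) (by positivity)
    (fun x => by have := hb x; unfold SlabHyp.lvl at this; linarith)
  have h2 := integral_sizes_le hρs hus hϑs (M := M) (fun x i => H.dbounds s hs x i)
  have hE := sobolevEnergy₃_nonneg (ρ s) (u s) (ϑ s)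
  have hK2 : 0 ≤ levelConst (Fin 3) C M ^ 2 := sq_nonneg _
  unfold SlabHyp.Phi
  have : 4 * (3 * levelConst (Fin 3) C M) ^ 2 *
      (1 + (∫ x, totSize₂ (ρ s) (u s) (ϑ s) x ^ 2) + (∫ x, totSize₃ (ρ s) (u s) (ϑ s) x ^ 2) +
        ∫ x, totSize₂ (ρ s) (u s) (ϑ s) x ^ 4) ≤
      36 * levelConst (Fin 3) C M ^ 2 * (1 + (108 + 20000000 * M ^ 2) * sobolevEnergy₃ (ρ s) (u s) (ϑ s)) := by
    have e : 4 * (3 * levelConst (Fin 3) C M) ^ 2 = 36 * levelConst (Fin 3) C M ^ 2 := by ring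
    rw [e]
    exact mul_le_mul_of_nonneg_left (by linarith) (by positivity)
  exact h1.trans this

/-- The vector version. [cite: Majda1984, Ch. 2 §2.1, proof of Thm 2.2] -/
theorem integral_norm_sq_le_Phi {s : ℝ} (hs : s ∈ Icc 0 τ) {P : UnitAddTorus (Fin 3) → EuclideanSpace ℝ (Fin 3)}
    (hP : Continuous P) (hb : ∀ x, ‖P x‖ ≤ 3 * levelConst (Fin 3) C M * H.lvl s x) : ∫ x, ‖P x‖ ^ 2 ≤ H.Phi s :=
  H.integral_sq_le_Phi hs (P := fun x => ‖P x‖) hP.norm fun x => by rw [abs_norm]; exact hb x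

/-! ### Finite-sum bookkeeping -/

omit H in
/-- `∑ⱼ (a qⱼ + c) = a ∑ⱼ qⱼ + 3c` on `Fin 3`. [folklore] -/
theorem sum₁_affine (q : Fin 3 → ℝ) (a c : ℝ) : ∑ j, (a * q j + c) = a * ∑ j, q j + 3 * c := by
  simp only [Finset.sum_add_distrib, Finset.mul_sum, Finset.sum_const, Finset.card_univ, Fintype.card_fin,
    nsmul_eq_mul, Nat.cast_ofNat]

omit H in
/-- The double-sum version (`9c`). [folklore] -/
theorem sum₂_affine (q : Fin 3 → Fin 3 → ℝ) (a c : ℝ) :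
    ∑ j, ∑ k, (a * q j k + c) = a * ∑ j, ∑ k, q j k + 9 * c := by
  simp only [Finset.sum_add_distrib, Finset.mul_sum, Finset.sum_const, Finset.card_univ,
    Fintype.card_fin, nsmul_eq_mul, Nat.cast_ofNat]
  ring

omit H in
/-- The triple-sum version (`27c`). [folklore] -/
theorem sum₃_affine (q : Fin 3 → Fin 3 → Fin 3 → ℝ) (a c : ℝ) :
    ∑ j, ∑ k, ∑ l, (a * q j k l + c) = a * ∑ j, ∑ k, ∑ l, q j k l + 27 * c := by
  simp only [Finset.sum_add_distrib, Finset.mul_sum, Finset.sum_const, Finset.card_univ,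
    Fintype.card_fin, nsmul_eq_mul, Nat.cast_ofNat]
  ring

/-! ### Energy inequalities level by level -/

/-- **Level 0.** [cite: Majda1984, Ch. 2 §2.1, proof of Thm 2.2] -/
theorem level₀_deriv {t : ℝ} (ht : t ∈ Icc 0 τ) :
    ∃ D : ℝ, HasDerivWithinAt
        (fun s => ∫ x, (coefA ζ ρ ϑ s x * ρ s x ^ 2 + ρ s x * ‖u s x‖ ^ 2 + coefD ρ ϑ s x * ϑ s x ^ 2)) D (Icc 0 τ) t ∧
      D ≤ 9 * B * en₀ (ρ t) (u t) (ϑ t) + 3 * (B * H.Phi t) := by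
  have sA := isSmoothSpaceTimeOn_coefA H.zeta H.sol
  have sB := isSmoothSpaceTimeOn_coefB H.zeta H.sol
  have sG := isSmoothSpaceTimeOn_coefG H.zeta H.sol
  have sD := isSmoothSpaceTimeOn_coefD H.sol
  have hΦ := H.Phi_nonneg t
  have h0 : ∫ _ : UnitAddTorus (Fin 3), (0 : ℝ) ^ 2 ≤ H.Phi t := by simpa using hΦ
  have h0' : ∫ _ : UnitAddTorus (Fin 3), ‖(0 : EuclideanSpace ℝ (Fin 3))‖ ^ 2 ≤ H.Phi t := by simpa using hΦ
  obtain ⟨D, hD, hle⟩ := word_deriv_le H.pos H.sol.smooth_density H.sol.smooth_temperature H.sol.smooth_velocity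
    H.sol.smooth_velocity sA H.sol.smooth_density sG sD ht (fun x => H.weights ht x) H.B_nonneg (fun x => H.hbd ht x)
    (P₁ := fun _ => 0) (P₂ := fun _ => 0) (P₃ := fun _ => 0) (isSmooth_const _) (isSmooth_const _) (isSmooth_const _)
    (fun x => H.sol.continuity t ht x) (fun x => congrFun (res₂_fun_eq_zero H.zeta H.sol ht) x)
    (fun x => congrFun (res₃_fun_eq_zero H.pos H.sol ht) x) h0 h0' h0
  exact ⟨D, hD, hle⟩

/-- **Level 1.** [cite: Majda1984, Ch. 2 §2.1, proof of Thm 2.2] -/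
theorem level₁_deriv {t : ℝ} (ht : t ∈ Icc 0 τ) :
    ∃ D : ℝ, HasDerivWithinAt
        (fun s => ∑ j, ∫ x, (coefA ζ ρ ϑ s x * partialDeriv j (ρ s) x ^ 2 + ρ s x * ‖partialDeriv j (u s) x‖ ^ 2 +
          coefD ρ ϑ s x * partialDeriv j (ϑ s) x ^ 2)) D (Icc 0 τ) t ∧
      D ≤ 9 * B * en₁ (ρ t) (u t) (ϑ t) + 3 * (3 * (B * H.Phi t)) := by
  have hU := H.uniq
  have sρ := H.sol.smooth_density; have su := H.sol.smooth_velocity; have sϑ := H.sol.smooth_temperature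
  have sA := isSmoothSpaceTimeOn_coefA H.zeta H.sol
  have sB := isSmoothSpaceTimeOn_coefB H.zeta H.sol
  have sG := isSmoothSpaceTimeOn_coefG H.zeta H.sol
  have sD := isSmoothSpaceTimeOn_coefD H.sol
  have hus := su.isSmooth_slice ht
  have hρs := sρ.isSmooth_slice ht
  have hϑs := sϑ.isSmooth_slice ht
  have hAs := sA.isSmooth_slice ht
  have hBs := sB.isSmooth_slice ht
  have hGs := sG.isSmooth_slice ht
  have key : ∀ j : Fin 3, ∃ D : ℝ, HasDerivWithinAt
      (fun s => ∫ x, (coefA ζ ρ ϑ s x * partialDeriv j (ρ s) x ^ 2 + ρ s x * ‖partialDeriv j (u s) x‖ ^ 2 +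
        coefD ρ ϑ s x * partialDeriv j (ϑ s) x ^ 2)) D (Icc 0 τ) t ∧
      D ≤ 9 * B * ((∫ x, partialDeriv j (ρ t) x ^ 2) + (∫ x, ‖partialDeriv j (u t) x‖ ^ 2) +
        ∫ x, partialDeriv j (ϑ t) x ^ 2) + 3 * (B * H.Phi t) := by
    intro j
    have hT₁ : IsSmooth (tcont (u t) (ρ t) (ρ t) (u t) j) := isSmooth_tcont hus hρs hρs hus j
    have hT₂ : IsSmooth (tmom (u t) (coefA ζ ρ ϑ t) (coefB ζ ρ t) (ρ t) (ϑ t) (u t) j) :=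
      isSmooth_tmom hus hAs hBs hρs hϑs hus j
    have hT₃ : IsSmooth (tcont (u t) (coefG ζ ρ ϑ t) (ϑ t) (u t) j) := isSmooth_tcont hus hGs hϑs hus j
    have hP₁ : IsSmooth (fun x => -tcont (u t) (ρ t) (ρ t) (u t) j x) := hT₁.neg
    have hP₂ : IsSmooth (fun x => -tmom (u t) (coefA ζ ρ ϑ t) (coefB ζ ρ t) (ρ t) (ϑ t) (u t) j x) := hT₂.neg
    have hP₃ : IsSmooth (fun x => -tcont (u t) (coefG ζ ρ ϑ t) (ϑ t) (u t) j x) := hT₃.neg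
    exact word_deriv_le H.pos (sρ.partialDeriv hU j) (sϑ.partialDeriv hU j) (su.partialDeriv hU j) su sA sρ sG sD ht
      (fun x => H.weights ht x) H.B_nonneg (fun x => H.hbd ht x) hP₁ hP₂ hP₃
      (fun x => res₁_level₁ H.pos H.sol ht j x) (fun x => res₂_level₁ H.zeta H.pos H.sol ht j x)
      (fun x => res₃_level₁ H.zeta H.pos H.sol ht j x)
      (H.integral_sq_le_Phi ht hP₁.continuous fun x => (H.cont_bounds ht j j j x).1)
      (H.integral_norm_sq_le_Phi ht hP₂.continuous fun x => (H.mom_bounds ht j j j x).1)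
      (H.integral_sq_le_Phi ht hP₃.continuous fun x => (H.temp_bounds ht j j j x).1)
  choose D hD using key
  refine ⟨∑ j, D j, HasDerivWithinAt.fun_sum fun j _ => (hD j).1, ?_⟩
  calc ∑ j, D j ≤ ∑ j, (9 * B * ((∫ x, partialDeriv j (ρ t) x ^ 2) + (∫ x, ‖partialDeriv j (u t) x‖ ^ 2) +
        ∫ x, partialDeriv j (ϑ t) x ^ 2) + 3 * (B * H.Phi t)) := Finset.sum_le_sum fun j _ => (hD j).2
    _ = 9 * B * en₁ (ρ t) (u t) (ϑ t) + 3 * (3 * (B * H.Phi t)) := by rw [sum₁_affine]; rfl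

/-- **Level 2.** [cite: Majda1984, Ch. 2 §2.1, proof of Thm 2.2] -/
theorem level₂_deriv {t : ℝ} (ht : t ∈ Icc 0 τ) :
    ∃ D : ℝ, HasDerivWithinAt
        (fun s => ∑ j, ∑ k, ∫ x, (coefA ζ ρ ϑ s x * partialDeriv k (partialDeriv j (ρ s)) x ^ 2 +
          ρ s x * ‖partialDeriv k (partialDeriv j (u s)) x‖ ^ 2 +
          coefD ρ ϑ s x * partialDeriv k (partialDeriv j (ϑ s)) x ^ 2)) D (Icc 0 τ) t ∧
      D ≤ 9 * B * en₂ (ρ t) (u t) (ϑ t) + 9 * (3 * (B * H.Phi t)) := by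
  have hU := H.uniq
  have sρ := H.sol.smooth_density; have su := H.sol.smooth_velocity; have sϑ := H.sol.smooth_temperature
  have sA := isSmoothSpaceTimeOn_coefA H.zeta H.sol
  have sB := isSmoothSpaceTimeOn_coefB H.zeta H.sol
  have sG := isSmoothSpaceTimeOn_coefG H.zeta H.sol
  have sD := isSmoothSpaceTimeOn_coefD H.sol
  have hus := su.isSmooth_slice ht
  have hρs := sρ.isSmooth_slice ht
  have hϑs := sϑ.isSmooth_slice ht
  have hAs := sA.isSmooth_slice ht
  have hBs := sB.isSmooth_slice ht
  have hGs := sG.isSmooth_slice ht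
  have key : ∀ j k : Fin 3, ∃ D : ℝ, HasDerivWithinAt
      (fun s => ∫ x, (coefA ζ ρ ϑ s x * partialDeriv k (partialDeriv j (ρ s)) x ^ 2 +
        ρ s x * ‖partialDeriv k (partialDeriv j (u s)) x‖ ^ 2 +
        coefD ρ ϑ s x * partialDeriv k (partialDeriv j (ϑ s)) x ^ 2)) D (Icc 0 τ) t ∧
      D ≤ 9 * B * ((∫ x, partialDeriv k (partialDeriv j (ρ t)) x ^ 2) +
        (∫ x, ‖partialDeriv k (partialDeriv j (u t)) x‖ ^ 2) + ∫ x, partialDeriv k (partialDeriv j (ϑ t)) x ^ 2) +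
        3 * (B * H.Phi t) := by
    intro j k
    have hT₁ : IsSmooth (tcont (u t) (ρ t) (ρ t) (u t) j) := isSmooth_tcont hus hρs hρs hus j
    have hT₁' : IsSmooth (tcont (u t) (ρ t) (partialDeriv j (ρ t)) (partialDeriv j (u t)) k) :=
      isSmooth_tcont hus hρs (hρs.partialDeriv j) (hus.partialDeriv j) k
    have hT₂ : IsSmooth (tmom (u t) (coefA ζ ρ ϑ t) (coefB ζ ρ t) (ρ t) (ϑ t) (u t) j) :=
      isSmooth_tmom hus hAs hBs hρs hϑs hus j
    have hT₂' : IsSmooth (tmom (u t) (coefA ζ ρ ϑ t) (coefB ζ ρ t) (partialDeriv j (ρ t)) (partialDeriv j (ϑ t))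
        (partialDeriv j (u t)) k) :=
      isSmooth_tmom hus hAs hBs (hρs.partialDeriv j) (hϑs.partialDeriv j) (hus.partialDeriv j) k
    have hT₃ : IsSmooth (tcont (u t) (coefG ζ ρ ϑ t) (ϑ t) (u t) j) := isSmooth_tcont hus hGs hϑs hus j
    have hT₃' : IsSmooth (tcont (u t) (coefG ζ ρ ϑ t) (partialDeriv j (ϑ t)) (partialDeriv j (u t)) k) :=
      isSmooth_tcont hus hGs (hϑs.partialDeriv j) (hus.partialDeriv j) k
    have hP₁ : IsSmooth (fun x => -(partialDeriv k (tcont (u t) (ρ t) (ρ t) (u t) j) x) -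
        tcont (u t) (ρ t) (partialDeriv j (ρ t)) (partialDeriv j (u t)) k x) := (hT₁.partialDeriv k).neg.sub hT₁'
    have hP₂ : IsSmooth (fun x => -(partialDeriv k (tmom (u t) (coefA ζ ρ ϑ t) (coefB ζ ρ t) (ρ t) (ϑ t) (u t) j) x) -
        tmom (u t) (coefA ζ ρ ϑ t) (coefB ζ ρ t) (partialDeriv j (ρ t)) (partialDeriv j (ϑ t))
          (partialDeriv j (u t)) k x) := (hT₂.partialDeriv k).neg.sub hT₂'
    have hP₃ : IsSmooth (fun x => -(partialDeriv k (tcont (u t) (coefG ζ ρ ϑ t) (ϑ t) (u t) j) x) -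
        tcont (u t) (coefG ζ ρ ϑ t) (partialDeriv j (ϑ t)) (partialDeriv j (u t)) k x) := (hT₃.partialDeriv k).neg.sub hT₃'
    exact word_deriv_le H.pos ((sρ.partialDeriv hU j).partialDeriv hU k) ((sϑ.partialDeriv hU j).partialDeriv hU k)
      ((su.partialDeriv hU j).partialDeriv hU k) su sA sρ sG sD ht
      (fun x => H.weights ht x) H.B_nonneg (fun x => H.hbd ht x) hP₁ hP₂ hP₃
      (fun x => res₁_level₂ H.pos H.sol ht j k x) (fun x => res₂_level₂ H.zeta H.pos H.sol ht j k x)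
      (fun x => res₃_level₂ H.zeta H.pos H.sol ht j k x)
      (H.integral_sq_le_Phi ht hP₁.continuous fun x => (H.cont_bounds ht j k k x).2.1)
      (H.integral_norm_sq_le_Phi ht hP₂.continuous fun x => (H.mom_bounds ht j k k x).2.1)
      (H.integral_sq_le_Phi ht hP₃.continuous fun x => (H.temp_bounds ht j k k x).2.1)
  choose D hD using key
  refine ⟨∑ j, ∑ k, D j k, HasDerivWithinAt.fun_sum fun j _ => HasDerivWithinAt.fun_sum fun k _ => (hD j k).1, ?_⟩
  calc ∑ j, ∑ k, D j k ≤ ∑ j, ∑ k, (9 * B * ((∫ x, partialDeriv k (partialDeriv j (ρ t)) x ^ 2) +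
        (∫ x, ‖partialDeriv k (partialDeriv j (u t)) x‖ ^ 2) + ∫ x, partialDeriv k (partialDeriv j (ϑ t)) x ^ 2) +
        3 * (B * H.Phi t)) := Finset.sum_le_sum fun j _ => Finset.sum_le_sum fun k _ => (hD j k).2
    _ = 9 * B * en₂ (ρ t) (u t) (ϑ t) + 9 * (3 * (B * H.Phi t)) := by
        rw [sum₂_affine (fun j k => (∫ x, partialDeriv k (partialDeriv j (ρ t)) x ^ 2) +
          (∫ x, ‖partialDeriv k (partialDeriv j (u t)) x‖ ^ 2) + ∫ x, partialDeriv k (partialDeriv j (ϑ t)) x ^ 2)]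
        rfl

/-- **Level 3.** [cite: Majda1984, Ch. 2 §2.1, proof of Thm 2.2] -/
theorem level₃_deriv {t : ℝ} (ht : t ∈ Icc 0 τ) :
    ∃ D : ℝ, HasDerivWithinAt
        (fun s => ∑ j, ∑ k, ∑ l, ∫ x, (coefA ζ ρ ϑ s x * partialDeriv l (partialDeriv k (partialDeriv j (ρ s))) x ^ 2 +
          ρ s x * ‖partialDeriv l (partialDeriv k (partialDeriv j (u s))) x‖ ^ 2 +
          coefD ρ ϑ s x * partialDeriv l (partialDeriv k (partialDeriv j (ϑ s))) x ^ 2)) D (Icc 0 τ) t ∧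
      D ≤ 9 * B * en₃ (ρ t) (u t) (ϑ t) + 27 * (3 * (B * H.Phi t)) := by
  have hU := H.uniq
  have sρ := H.sol.smooth_density; have su := H.sol.smooth_velocity; have sϑ := H.sol.smooth_temperature
  have sA := isSmoothSpaceTimeOn_coefA H.zeta H.sol
  have sB := isSmoothSpaceTimeOn_coefB H.zeta H.sol
  have sG := isSmoothSpaceTimeOn_coefG H.zeta H.sol
  have sD := isSmoothSpaceTimeOn_coefD H.sol
  have hus := su.isSmooth_slice ht
  have hρs := sρ.isSmooth_slice ht
  have hϑs := sϑ.isSmooth_slice ht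
  have hAs := sA.isSmooth_slice ht
  have hBs := sB.isSmooth_slice ht
  have hGs := sG.isSmooth_slice ht
  have key : ∀ j k l : Fin 3, ∃ D : ℝ, HasDerivWithinAt
      (fun s => ∫ x, (coefA ζ ρ ϑ s x * partialDeriv l (partialDeriv k (partialDeriv j (ρ s))) x ^ 2 +
        ρ s x * ‖partialDeriv l (partialDeriv k (partialDeriv j (u s))) x‖ ^ 2 +
        coefD ρ ϑ s x * partialDeriv l (partialDeriv k (partialDeriv j (ϑ s))) x ^ 2)) D (Icc 0 τ) t ∧
      D ≤ 9 * B * ((∫ x, partialDeriv l (partialDeriv k (partialDeriv j (ρ t))) x ^ 2) +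
        (∫ x, ‖partialDeriv l (partialDeriv k (partialDeriv j (u t))) x‖ ^ 2) +
        ∫ x, partialDeriv l (partialDeriv k (partialDeriv j (ϑ t))) x ^ 2) + 3 * (B * H.Phi t) := by
    intro j k l
    have hT₁ : IsSmooth (tcont (u t) (ρ t) (ρ t) (u t) j) := isSmooth_tcont hus hρs hρs hus j
    have hT₁' : IsSmooth (tcont (u t) (ρ t) (partialDeriv j (ρ t)) (partialDeriv j (u t)) k) :=
      isSmooth_tcont hus hρs (hρs.partialDeriv j) (hus.partialDeriv j) k
    have hT₁'' : IsSmooth (tcont (u t) (ρ t) (partialDeriv k (partialDeriv j (ρ t))) (partialDeriv k (partialDeriv j (u t))) l) :=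
      isSmooth_tcont hus hρs ((hρs.partialDeriv j).partialDeriv k) ((hus.partialDeriv j).partialDeriv k) l
    have hT₂ : IsSmooth (tmom (u t) (coefA ζ ρ ϑ t) (coefB ζ ρ t) (ρ t) (ϑ t) (u t) j) :=
      isSmooth_tmom hus hAs hBs hρs hϑs hus j
    have hT₂' : IsSmooth (tmom (u t) (coefA ζ ρ ϑ t) (coefB ζ ρ t) (partialDeriv j (ρ t)) (partialDeriv j (ϑ t))
        (partialDeriv j (u t)) k) :=
      isSmooth_tmom hus hAs hBs (hρs.partialDeriv j) (hϑs.partialDeriv j) (hus.partialDeriv j) k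
    have hT₂'' : IsSmooth (tmom (u t) (coefA ζ ρ ϑ t) (coefB ζ ρ t) (partialDeriv k (partialDeriv j (ρ t)))
        (partialDeriv k (partialDeriv j (ϑ t))) (partialDeriv k (partialDeriv j (u t))) l) :=
      isSmooth_tmom hus hAs hBs ((hρs.partialDeriv j).partialDeriv k) ((hϑs.partialDeriv j).partialDeriv k)
        ((hus.partialDeriv j).partialDeriv k) l
    have hT₃ : IsSmooth (tcont (u t) (coefG ζ ρ ϑ t) (ϑ t) (u t) j) := isSmooth_tcont hus hGs hϑs hus j
    have hT₃' : IsSmooth (tcont (u t) (coefG ζ ρ ϑ t) (partialDeriv j (ϑ t)) (partialDeriv j (u t)) k) :=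
      isSmooth_tcont hus hGs (hϑs.partialDeriv j) (hus.partialDeriv j) k
    have hT₃'' : IsSmooth (tcont (u t) (coefG ζ ρ ϑ t) (partialDeriv k (partialDeriv j (ϑ t)))
        (partialDeriv k (partialDeriv j (u t))) l) :=
      isSmooth_tcont hus hGs ((hϑs.partialDeriv j).partialDeriv k) ((hus.partialDeriv j).partialDeriv k) l
    have hP₁ : IsSmooth (fun x => -(partialDeriv l (partialDeriv k (tcont (u t) (ρ t) (ρ t) (u t) j)) x) -
        partialDeriv l (tcont (u t) (ρ t) (partialDeriv j (ρ t)) (partialDeriv j (u t)) k) x -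
        tcont (u t) (ρ t) (partialDeriv k (partialDeriv j (ρ t))) (partialDeriv k (partialDeriv j (u t))) l x) :=
      (((hT₁.partialDeriv k).partialDeriv l).neg.sub (hT₁'.partialDeriv l)).sub hT₁''
    have hP₂ : IsSmooth (fun x =>
        -(partialDeriv l (partialDeriv k (tmom (u t) (coefA ζ ρ ϑ t) (coefB ζ ρ t) (ρ t) (ϑ t) (u t) j)) x) -
        partialDeriv l (tmom (u t) (coefA ζ ρ ϑ t) (coefB ζ ρ t) (partialDeriv j (ρ t)) (partialDeriv j (ϑ t))
          (partialDeriv j (u t)) k) x -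
        tmom (u t) (coefA ζ ρ ϑ t) (coefB ζ ρ t) (partialDeriv k (partialDeriv j (ρ t)))
          (partialDeriv k (partialDeriv j (ϑ t))) (partialDeriv k (partialDeriv j (u t))) l x) :=
      (((hT₂.partialDeriv k).partialDeriv l).neg.sub (hT₂'.partialDeriv l)).sub hT₂''
    have hP₃ : IsSmooth (fun x => -(partialDeriv l (partialDeriv k (tcont (u t) (coefG ζ ρ ϑ t) (ϑ t) (u t) j)) x) -
        partialDeriv l (tcont (u t) (coefG ζ ρ ϑ t) (partialDeriv j (ϑ t)) (partialDeriv j (u t)) k) x -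
        tcont (u t) (coefG ζ ρ ϑ t) (partialDeriv k (partialDeriv j (ϑ t))) (partialDeriv k (partialDeriv j (u t))) l x) :=
      (((hT₃.partialDeriv k).partialDeriv l).neg.sub (hT₃'.partialDeriv l)).sub hT₃''
    exact word_deriv_le H.pos (((sρ.partialDeriv hU j).partialDeriv hU k).partialDeriv hU l)
      (((sϑ.partialDeriv hU j).partialDeriv hU k).partialDeriv hU l)
      (((su.partialDeriv hU j).partialDeriv hU k).partialDeriv hU l) su sA sρ sG sD ht
      (fun x => H.weights ht x) H.B_nonneg (fun x => H.hbd ht x) hP₁ hP₂ hP₃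
      (fun x => res₁_level₃ H.pos H.sol ht j k l x) (fun x => res₂_level₃ H.zeta H.pos H.sol ht j k l x)
      (fun x => res₃_level₃ H.zeta H.pos H.sol ht j k l x)
      (H.integral_sq_le_Phi ht hP₁.continuous fun x => (H.cont_bounds ht j k l x).2.2)
      (H.integral_norm_sq_le_Phi ht hP₂.continuous fun x => (H.mom_bounds ht j k l x).2.2)
      (H.integral_sq_le_Phi ht hP₃.continuous fun x => (H.temp_bounds ht j k l x).2.2)
  choose D hD using key
  refine ⟨∑ j, ∑ k, ∑ l, D j k l, HasDerivWithinAt.fun_sum fun j _ => HasDerivWithinAt.fun_sum fun k _ =>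
    HasDerivWithinAt.fun_sum fun l _ => (hD j k l).1, ?_⟩
  calc ∑ j, ∑ k, ∑ l, D j k l ≤ ∑ j, ∑ k, ∑ l, (9 * B * ((∫ x, partialDeriv l (partialDeriv k (partialDeriv j (ρ t))) x ^ 2) +
        (∫ x, ‖partialDeriv l (partialDeriv k (partialDeriv j (u t))) x‖ ^ 2) +
        ∫ x, partialDeriv l (partialDeriv k (partialDeriv j (ϑ t))) x ^ 2) + 3 * (B * H.Phi t)) :=
        Finset.sum_le_sum fun j _ => Finset.sum_le_sum fun k _ => Finset.sum_le_sum fun l _ => (hD j k l).2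
    _ = 9 * B * en₃ (ρ t) (u t) (ϑ t) + 27 * (3 * (B * H.Phi t)) := by
        rw [sum₃_affine (fun j k l => (∫ x, partialDeriv l (partialDeriv k (partialDeriv j (ρ t))) x ^ 2) +
          (∫ x, ‖partialDeriv l (partialDeriv k (partialDeriv j (u t))) x‖ ^ 2) +
          ∫ x, partialDeriv l (partialDeriv k (partialDeriv j (ϑ t))) x ^ 2)]
        rfl

/-! ### Assembly: the differential inequality and Grönwall -/

/-- The growth constant `γ = 9B + 4320 B K² (109 + 2·10⁷ M²)`. [folklore] -/
def gamma (_ : SlabHyp ζ f τ M C δ B ρ ϑ u) : ℝ :=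
  9 * B + 4320 * B * levelConst (Fin 3) C M ^ 2 * (108 + 20000000 * M ^ 2 + 1)

/-- `γ ≥ 0`. [folklore] -/
theorem gamma_nonneg : 0 ≤ H.gamma := by
  unfold SlabHyp.gamma
  have := H.B_nonneg
  have : 0 ≤ levelConst (Fin 3) C M ^ 2 := sq_nonneg _
  have : 0 ≤ M ^ 2 := sq_nonneg M
  positivity

/-- The weighted energy `ℰ(s)` (all 40 words). [cite: Majda1984, Ch. 2 §2.1 (2.8)] -/
def wE (_ : SlabHyp ζ f τ M C δ B ρ ϑ u) (s : ℝ) : ℝ :=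
  (∫ x, (coefA ζ ρ ϑ s x * ρ s x ^ 2 + ρ s x * ‖u s x‖ ^ 2 + coefD ρ ϑ s x * ϑ s x ^ 2)) +
  (∑ j, ∫ x, (coefA ζ ρ ϑ s x * partialDeriv j (ρ s) x ^ 2 + ρ s x * ‖partialDeriv j (u s) x‖ ^ 2 +
    coefD ρ ϑ s x * partialDeriv j (ϑ s) x ^ 2)) +
  (∑ j, ∑ k, ∫ x, (coefA ζ ρ ϑ s x * partialDeriv k (partialDeriv j (ρ s)) x ^ 2 +
    ρ s x * ‖partialDeriv k (partialDeriv j (u s)) x‖ ^ 2 + coefD ρ ϑ s x * partialDeriv k (partialDeriv j (ϑ s)) x ^ 2)) +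
  ∑ j, ∑ k, ∑ l, ∫ x, (coefA ζ ρ ϑ s x * partialDeriv l (partialDeriv k (partialDeriv j (ρ s))) x ^ 2 +
    ρ s x * ‖partialDeriv l (partialDeriv k (partialDeriv j (u s))) x‖ ^ 2 +
    coefD ρ ϑ s x * partialDeriv l (partialDeriv k (partialDeriv j (ϑ s))) x ^ 2)

/-- **Equivalence of the weighted and the Sobolev energy**: `δ E₃ ≤ ℰ ≤ B E₃`. [folklore] -/
theorem wE_bounds {s : ℝ} (hs : s ∈ Icc 0 τ) :
    δ * sobolevEnergy₃ (ρ s) (u s) (ϑ s) ≤ H.wE s ∧ H.wE s ≤ B * sobolevEnergy₃ (ρ s) (u s) (ϑ s) := by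
  have hρs := H.sol.smooth_density.isSmooth_slice hs
  have hus := H.sol.smooth_velocity.isSmooth_slice hs
  have hϑs := H.sol.smooth_temperature.isSmooth_slice hs
  have hAs : IsSmooth (coefA ζ ρ ϑ s) := (isSmoothSpaceTimeOn_coefA H.zeta H.sol).isSmooth_slice hs
  have hDs : IsSmooth (coefD ρ ϑ s) := (isSmoothSpaceTimeOn_coefD H.sol).isSmooth_slice hs
  have hw := fun x => H.wbd hs x
  have w0 := weighted_word_bounds hρs hϑs hus hAs hρs hDs hw
  have w1 := fun j : Fin 3 => weighted_word_bounds (hρs.partialDeriv j) (hϑs.partialDeriv j) (hus.partialDeriv j)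
    hAs hρs hDs hw
  have w2 := fun j k : Fin 3 => weighted_word_bounds ((hρs.partialDeriv j).partialDeriv k)
    ((hϑs.partialDeriv j).partialDeriv k) ((hus.partialDeriv j).partialDeriv k) hAs hρs hDs hw
  have w3 := fun j k l : Fin 3 => weighted_word_bounds (((hρs.partialDeriv j).partialDeriv k).partialDeriv l)
    (((hϑs.partialDeriv j).partialDeriv k).partialDeriv l) (((hus.partialDeriv j).partialDeriv k).partialDeriv l)
    hAs hρs hDs hw
  have l1 := Finset.sum_le_sum fun j (_ : j ∈ Finset.univ) => (w1 j).1
  have u1 := Finset.sum_le_sum fun j (_ : j ∈ Finset.univ) => (w1 j).2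
  have l2 := Finset.sum_le_sum fun j (_ : j ∈ Finset.univ) => Finset.sum_le_sum fun k (_ : k ∈ Finset.univ) => (w2 j k).1
  have u2 := Finset.sum_le_sum fun j (_ : j ∈ Finset.univ) => Finset.sum_le_sum fun k (_ : k ∈ Finset.univ) => (w2 j k).2
  have l3 := Finset.sum_le_sum fun j (_ : j ∈ Finset.univ) => Finset.sum_le_sum fun k (_ : k ∈ Finset.univ) =>
    Finset.sum_le_sum fun l (_ : l ∈ Finset.univ) => (w3 j k l).1
  have u3 := Finset.sum_le_sum fun j (_ : j ∈ Finset.univ) => Finset.sum_le_sum fun k (_ : k ∈ Finset.univ) =>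
    Finset.sum_le_sum fun l (_ : l ∈ Finset.univ) => (w3 j k l).2
  simp only [← Finset.mul_sum] at l1 u1 l2 u2 l3 u3
  unfold SlabHyp.wE sobolevEnergy₃ en₀ en₁ en₂ en₃
  constructor
  · linarith [w0.1]
  · linarith [w0.2]

/-- **The differential inequality** `ℰ'(t) ≤ (γ/δ)(ℰ(t) + δ)`. [cite: Majda1984, Ch. 2 §2.1 (2.9)–(2.10)] -/
theorem wE_deriv {t : ℝ} (ht : t ∈ Icc 0 τ) :
    ∃ D : ℝ, HasDerivWithinAt H.wE D (Icc 0 τ) t ∧ D ≤ H.gamma / δ * (H.wE t + δ) := by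
  obtain ⟨D₀, hD₀, b₀⟩ := H.level₀_deriv ht
  obtain ⟨D₁, hD₁, b₁⟩ := H.level₁_deriv ht
  obtain ⟨D₂, hD₂, b₂⟩ := H.level₂_deriv ht
  obtain ⟨D₃, hD₃, b₃⟩ := H.level₃_deriv ht
  refine ⟨D₀ + D₁ + D₂ + D₃, ?_, ?_⟩
  · have h := ((hD₀.add hD₁).add hD₂).add hD₃
    exact h
  · set E := sobolevEnergy₃ (ρ t) (u t) (ϑ t) with hE
    set K := levelConst (Fin 3) C M with hK
    have hB := H.B_nonneg
    have hδ := H.δ_pos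
    have hE0 : 0 ≤ E := sobolevEnergy₃_nonneg _ _ _
    have hK2 : 0 ≤ K ^ 2 := sq_nonneg _
    have hM2 : 0 ≤ M ^ 2 := sq_nonneg _
    have hsum : D₀ + D₁ + D₂ + D₃ ≤ 9 * B * E + 120 * (B * H.Phi t) := by
      have : 9 * B * en₀ (ρ t) (u t) (ϑ t) + 9 * B * en₁ (ρ t) (u t) (ϑ t) + 9 * B * en₂ (ρ t) (u t) (ϑ t) +
          9 * B * en₃ (ρ t) (u t) (ϑ t) = 9 * B * E := by
        rw [hE]; unfold sobolevEnergy₃; ring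
      linarith
    have hPhi : H.Phi t = 36 * K ^ 2 * (1 + (108 + 20000000 * M ^ 2) * E) := rfl
    have hγ : H.gamma = 9 * B + 4320 * B * K ^ 2 * (108 + 20000000 * M ^ 2 + 1) := rfl
    -- `9B E + 120 B Φ ≤ γ (E + 1)`
    have h1 : 9 * B * E + 120 * (B * H.Phi t) ≤ H.gamma * (E + 1) := by
      rw [hPhi, hγ]
      nlinarith [mul_nonneg hB hK2, mul_nonneg (mul_nonneg hB hK2) hE0, mul_nonneg (mul_nonneg hB hK2) hM2,
        mul_nonneg (mul_nonneg (mul_nonneg hB hK2) hM2) hE0, mul_nonneg hB hE0]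
    -- `E ≤ ℰ/δ`
    have h2 : E ≤ H.wE t / δ := by
      rw [le_div_iff₀ hδ, mul_comm]; exact (H.wE_bounds ht).1
    have hγ0 := H.gamma_nonneg
    calc D₀ + D₁ + D₂ + D₃ ≤ H.gamma * (E + 1) := hsum.trans h1
      _ ≤ H.gamma * (H.wE t / δ + 1) := by gcongr
      _ = H.gamma / δ * (H.wE t + δ) := by field_simp

/-- **The `H³` energy bound on a slab** (Majda 1984, Thm 2.2, proof):
`E₃(t) ≤ (B E₃(0) + δ) e^{(γ/δ) t} / δ` for `t ∈ [0, τ]`. [cite: Majda1984, Ch. 2 §2.1 Thm 2.2] -/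
theorem energy_le {t : ℝ} (ht : t ∈ Icc 0 τ) :
    sobolevEnergy₃ (ρ t) (u t) (ϑ t) ≤
      (B * sobolevEnergy₃ (ρ 0) (u 0) (ϑ 0) + δ) * Real.exp (H.gamma / δ * t) / δ := by
  have hδ := H.δ_pos
  have hderiv := fun s (hs : s ∈ Icc 0 τ) => H.wE_deriv hs
  choose! D hD using hderiv
  set F : ℝ → ℝ := fun s => H.wE s + δ with hF
  have hFd : ∀ s ∈ Icc 0 τ, HasDerivWithinAt F (D s) (Icc 0 τ) s := fun s hs => by
    have h := (hD s hs).1.add_const δ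
    exact h
  have hFc : ContinuousOn F (Icc 0 τ) := fun s hs => (hFd s hs).continuousWithinAt
  have hder : ∀ s ∈ Ico 0 τ, HasDerivWithinAt F (D s) (Ici s) s := fun s hs =>
    ((hFd s (Ico_subset_Icc_self hs)).mono (Icc_subset_Icc hs.1 le_rfl)).mono_of_mem_nhdsWithin (Icc_mem_nhdsGE hs.2)
  have hgr := le_gronwallBound_of_liminf_deriv_right_le (f := F) (f' := D) (δ := F 0) (K := H.gamma / δ) (ε := 0)
    (a := 0) (b := τ) hFc (fun s hs r hr => (hder s hs).liminf_right_slope_le hr) le_rfl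
    (fun s hs => by rw [add_zero]; exact (hD s (Ico_subset_Icc_self hs)).2)
  have h := hgr t ht
  rw [gronwallBound_ε0, sub_zero] at h
  -- unwrap
  have hw0 : H.wE 0 ≤ B * sobolevEnergy₃ (ρ 0) (u 0) (ϑ 0) := (H.wE_bounds ⟨le_rfl, H.pos.le⟩).2
  have hwt : δ * sobolevEnergy₃ (ρ t) (u t) (ϑ t) ≤ H.wE t := (H.wE_bounds ht).1
  have hexp : 0 ≤ Real.exp (H.gamma / δ * t) := (Real.exp_pos _).le
  rw [le_div_iff₀ hδ, mul_comm]
  have hFt : F t = H.wE t + δ := rfl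
  have hF0 : F 0 = H.wE 0 + δ := rfl
  calc δ * sobolevEnergy₃ (ρ t) (u t) (ϑ t) ≤ H.wE t := hwt
    _ ≤ F t := by rw [hFt]; linarith
    _ ≤ F 0 * Real.exp (H.gamma / δ * t) := h
    _ ≤ (B * sobolevEnergy₃ (ρ 0) (u 0) (ϑ 0) + δ) * Real.exp (H.gamma / δ * t) := by
        rw [hF0]; exact mul_le_mul_of_nonneg_right (by linarith) hexp

end SlabHyp

end Slab

/-! ## The a-priori estimate: packaged statements -/

section Main

variable {ζ f : ℝ → ℝ} {ρm : ℝ}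

/-- `‖∂ᵢφ(x)‖ ≤ ‖Dφ(x)‖` for smooth `φ` on the torus. [folklore] -/
theorem norm_partialDeriv_le_norm_fderiv {d : Type*} [Fintype d] [DecidableEq d] {F : Type*} [NormedAddCommGroup F]
    [NormedSpace ℝ F] {φ : UnitAddTorus d → F} (hφ : IsSmooth φ) (i : d) (x : UnitAddTorus d) :
    ‖partialDeriv i φ x‖ ≤ ‖Torus.fderiv φ x‖ := by
  rw [partialDeriv_eq_fderiv_apply (hφ.isContDiff (by simp)) i x]
  refine (ContinuousLinearMap.le_opNorm _ _).trans ?_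
  have : ‖(EuclideanSpace.single i (1 : ℝ))‖ = 1 := by
    rw [EuclideanSpace.norm_eq]; simp [Finset.sum_ite_eq']
  rw [this, mul_one]

/-- **`H³` a-priori estimate on slabs** (Majda 1984, Thm 2.2, sharp `C¹` continuation form, the
energy bound): given `ζ` (`(sζ)' > 0` on `(0, ρ̄)`), a level `M > 0` and a ceiling `ρ̄₁ < ρ̄`, there
are `L ≥ 0`, `δ > 0`, `B ≥ 0` such that every smooth solution of the primitive Euler system of the
athermal monatomic law on `[0, τ] × 𝕋³` with `M⁻¹ ≤ ρ ≤ ρ̄₁`, `M⁻¹ ≤ ϑ ≤ M`,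
`‖u‖, |∂ρ|, ‖∂u‖, |∂ϑ| ≤ M` satisfies `E₃(t) ≤ (B E₃(0) + δ) e^{Lt} / δ` on `[0, τ]` — constants
independent of `τ` and of the solution. [cite: Majda1984, Ch. 2 §2.1 Thm 2.2] -/
theorem apriori_slab (hζ : ContDiff ℝ ∞ ζ) (hζ' : ∀ r ∈ Ioo 0 ρm, 0 < deriv (fun s : ℝ => s * ζ s) r)
    {M ρ₁ : ℝ} (hM : 0 < M) (hρ₁ : ρ₁ < ρm) :
    ∃ L δ B : ℝ, 0 ≤ L ∧ 0 < δ ∧ 0 ≤ B ∧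
      ∀ ⦃τ : ℝ⦄, 0 < τ → ∀ ⦃ρ ϑ : ℝ → UnitAddTorus (Fin 3) → ℝ⦄
        ⦃u : ℝ → UnitAddTorus (Fin 3) → EuclideanSpace ℝ (Fin 3)⦄,
        IsPrimitiveEulerSolutionOn (EulerEOS.monatomicExcess ζ f) (Icc 0 τ) ρ u ϑ →
        (∀ s ∈ Icc 0 τ, ∀ x, M⁻¹ ≤ ρ s x ∧ ρ s x ≤ ρ₁ ∧ M⁻¹ ≤ ϑ s x ∧ ϑ s x ≤ M ∧ ‖u s x‖ ≤ M ∧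
          ∀ i, |partialDeriv i (ρ s) x| ≤ M ∧ ‖partialDeriv i (u s) x‖ ≤ M ∧ |partialDeriv i (ϑ s) x| ≤ M) →
        ∀ t ∈ Icc 0 τ, sobolevEnergy₃ (ρ t) (u t) (ϑ t) ≤
          (B * sobolevEnergy₃ (ρ 0) (u 0) (ϑ 0) + δ) * Real.exp (L * t) / δ := by
  obtain ⟨C, δ, B, hC, hδ, hB, Hs⟩ := exists_slab_bounds (f := f) hζ hζ' hM hρ₁
  set γ : ℝ := 9 * B + 4320 * B * levelConst (Fin 3) C M ^ 2 * (108 + 20000000 * M ^ 2 + 1) with hγ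
  have hγ0 : 0 ≤ γ := by
    have : 0 ≤ levelConst (Fin 3) C M ^ 2 := sq_nonneg _
    have : 0 ≤ M ^ 2 := sq_nonneg M
    positivity
  refine ⟨γ / δ, δ, B, div_nonneg hγ0 hδ.le, hδ, hB, ?_⟩
  intro τ hτ ρ ϑ u h hb t ht
  have H : SlabHyp ζ f τ M C δ B ρ ϑ u :=
    { pos := hτ, zeta := hζ, sol := h, M_nonneg := hM.le, one_le := hC, δ_pos := hδ, B_nonneg := hB,
      dbounds := fun s hs x i => (hb s hs x).2.2.2.2.2 i,
      coef := fun s hs x => Hs hτ h hb s hs x }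
  exact H.energy_le ht

/-- **`H³` a-priori estimate along a classical solution on `[0, T)`** under the hypotheses of the
continuation clause (ii) of `CompressibleEulerLocalWellPosedness`: the Sobolev energy `E₃(t)` is
bounded on `[0, T)`. [cite: Majda1984, Ch. 2 §2.1 Thm 2.2] -/
theorem apriori_Ico (hζ : ContDiff ℝ ∞ ζ) (hζ' : ∀ r ∈ Ioo 0 ρm, 0 < deriv (fun s : ℝ => s * ζ s) r)
    {T : ℝ} (hT : 0 < T) {ρ ϑ : ℝ → UnitAddTorus (Fin 3) → ℝ}
    {u : ℝ → UnitAddTorus (Fin 3) → EuclideanSpace ℝ (Fin 3)}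
    (h : IsClassicalEulerSolution (EulerEOS.monatomicExcess ζ f) T ρ u ϑ)
    (hb : ∃ M ρ₁ : ℝ, ρ₁ < ρm ∧ ∀ t ∈ Ico 0 T, ∀ x,
      M⁻¹ ≤ ρ t x ∧ ρ t x ≤ ρ₁ ∧ M⁻¹ ≤ ϑ t x ∧ ϑ t x ≤ M ∧ ‖u t x‖ ≤ M ∧
      ‖Torus.fderiv (ρ t) x‖ ≤ M ∧ ‖Torus.fderiv (u t) x‖ ≤ M ∧ ‖Torus.fderiv (ϑ t) x‖ ≤ M) :
    ∃ R : ℝ, ∀ t ∈ Ico 0 T, sobolevEnergy₃ (ρ t) (u t) (ϑ t) ≤ R := by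
  obtain ⟨M, ρ₁, hρ₁, hb⟩ := hb
  have h0 : (0 : ℝ) ∈ Ico 0 T := ⟨le_rfl, hT⟩
  have hMpos : 0 < M := by
    obtain ⟨-, -, h1, h2, -⟩ := hb 0 h0 0
    exact (h.temperature_pos 0 h0 0).trans_le h2
  obtain ⟨L, δ, B, hL, hδ, hB, H⟩ := apriori_slab (f := f) hζ hζ' hMpos hρ₁
  refine ⟨(B * sobolevEnergy₃ (ρ 0) (u 0) (ϑ 0) + δ) * Real.exp (L * T) / δ, fun t ht => ?_⟩
  -- restrict to the slab `[0, τ]`, `τ = (t + T)/2`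
  set τ : ℝ := (t + T) / 2 with hτ
  have htτ : t < τ := by rw [hτ]; linarith [ht.2]
  have hτT : τ < T := by rw [hτ]; linarith [ht.2]
  have hτ0 : 0 < τ := ht.1.trans_lt htτ
  have hp : ContDiffOn ℝ ∞ (uncurry (EulerEOS.monatomicExcess ζ f).p) (Ioi 0 ×ˢ Ioi 0) :=
    (contDiff_monatomicExcess_p hζ).contDiffOn
  have he : ContDiffOn ℝ ∞ (uncurry (EulerEOS.monatomicExcess ζ f).e) (Ioi 0 ×ˢ Ioi 0) :=
    contDiff_monatomicExcess_e.contDiffOn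
  have hsub : Icc 0 τ ⊆ Ico 0 T := fun s hs => ⟨hs.1, hs.2.trans_lt hτT⟩
  have hU : UniqueDiffOn ℝ (Icc 0 τ) := uniqueDiffOn_Icc hτ0
  have k := ((isClassicalEulerSolutionOn_Ico_iff.2 h).mono he hsub hU).primitive hU hp he
  have hb' : ∀ s ∈ Icc 0 τ, ∀ x, M⁻¹ ≤ ρ s x ∧ ρ s x ≤ ρ₁ ∧ M⁻¹ ≤ ϑ s x ∧ ϑ s x ≤ M ∧ ‖u s x‖ ≤ M ∧
      ∀ i, |partialDeriv i (ρ s) x| ≤ M ∧ ‖partialDeriv i (u s) x‖ ≤ M ∧ |partialDeriv i (ϑ s) x| ≤ M := by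
    intro s hs x
    obtain ⟨b1, b2, b3, b4, b5, b6, b7, b8⟩ := hb s (hsub hs) x
    have hρs := k.smooth_density.isSmooth_slice hs
    have hus := k.smooth_velocity.isSmooth_slice hs
    have hϑs := k.smooth_temperature.isSmooth_slice hs
    refine ⟨b1, b2, b3, b4, b5, fun i => ⟨?_, ?_, ?_⟩⟩
    · rw [← Real.norm_eq_abs]; exact (norm_partialDeriv_le_norm_fderiv hρs i x).trans b6
    · exact (norm_partialDeriv_le_norm_fderiv hus i x).trans b7
    · rw [← Real.norm_eq_abs]; exact (norm_partialDeriv_le_norm_fderiv hϑs i x).trans b8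
  have main := H hτ0 k hb' t ⟨ht.1, htτ.le⟩
  refine main.trans ?_
  have hE0 := sobolevEnergy₃_nonneg (ρ 0) (u 0) (ϑ 0)
  have hnum : 0 ≤ B * sobolevEnergy₃ (ρ 0) (u 0) (ϑ 0) + δ := by positivity
  have hexp : Real.exp (L * t) ≤ Real.exp (L * T) := Real.exp_le_exp.2 (mul_le_mul_of_nonneg_left ht.2.le hL)
  exact div_le_div_of_nonneg_right (mul_le_mul_of_nonneg_left hexp hnum) hδ.le

end Main

end CompressibleEuler

end Literature.Analysis.FluidPDE

end
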